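import Mathlib.MeasureTheory.Integral.Prod
import Literature.Combinatorics.Additive.PFR.MeasureEntropy
import Literature.Combinatorics.Additive.PFR.KernelDisintegration
import Mathlib.MeasureTheory.Group.Arithmetic
import HarnessLib

/-!
# PFR support: entropy, mutual information and Ruzsa distance of kernels

Topic `Literature/Combinatorics/Additive` — supporting library for the polynomial Freiman–Ruzsa theorem
(`Literature.Combinatorics.Additive.polynomialFreimanRuzsa`, Gowers–Green–Manners–Tao 2025).

**Provenance.** This file is a mechanical port of part of the public Lean formalisation of PFR,
`teorth/pfr` (https://github.com/teorth/pfr), commit `85d5879ae144` ("Bump to v4.32.0", Mathlib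
`81a5d257` = this tree's Mathlib), files:
* `PFR/ForMathlib/Entropy/Kernel/Basic.lean`
* `PFR/ForMathlib/Entropy/Kernel/MutualInfo.lean`
* `PFR/ForMathlib/Entropy/Kernel/Group.lean`
* `PFR/ForMathlib/Entropy/Kernel/RuzsaDist.lean`
Copyright (c) 2023–2026 the PFR project contributors (T. Tao et al.); released under the Apache License 2.0;
see the upstream repository for the list of authors of each file. Changes made here (D-0022 layout):
upstream `module`/`public section` markers removed; declarations moved under
`namespace Literature.Combinatorics.Additive.PFR`: upstream `namespace ProbabilityTheory` content and root-level
content directly; upstream blocks `namespace X.Y` over a Mathlib namespace are kept textually (so that upstream's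
name resolution inside them is unchanged) but every declaration in them that is NOT a generalized-field-notation
extension is renamed into `Literature.Combinatorics.Additive.PFR` (kernel lemmas into `….PFR.Kernel`); what stays
in a Mathlib namespace are exactly the dot-notation extensions of Mathlib structures/predicates — a lemma `T.foo`
with an explicit argument (or result) of type `T …` for `T` among `IndepFun`, `iIndepFun`, `IdentDistrib`, `Kernel`,
`Measure`, `MeasurePreserving`, `ProbabilityMeasure`, `Set`, … — which keep the true Mathlib name `<ns>.T.foo` so that
upstream's `h.foo` / `.foo` call syntax elaborates (CONVENTIONS §2, deliberate dot-notation extensions). Exact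
duplicates of Mathlib lemmas noticed in review are dropped in favour of Mathlib's; every declaration got a
docstring with a provenance tag. Upstream's global attribute edits on Mathlib declarations (e.g.
`attribute [symm] ProbabilityTheory.IdentDistrib.symm`, `attribute [mk_iff] ProbabilityTheory.IdentDistrib`) are
kept as upstream has them. Statements and proofs are otherwise verbatim.

-/

namespace Literature.Combinatorics.Additive.PFR
end Literature.Combinatorics.Additive.PFR
open Literature.Combinatorics.Additive.PFR
-- sub-namespaces receiving upstream's non-dot-notation Mathlib-namespace lemmas (registered up front so that
-- `open` can name them inside the verbatim upstream blocks)
namespace Literature.Combinatorics.Additive.PFR.Kernel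
end Literature.Combinatorics.Additive.PFR.Kernel

/-! ## Port of `PFR/ForMathlib/Entropy/Kernel/Basic.lean` -/
section PFR_ForMathlib_Entropy_Kernel_Basic
/-!
# Entropy of a kernel with respect to a measure

## Main definitions

* `Kernel.entropy`: entropy of a kernel `κ` with respect to a measure `μ`,
  `μ[fun t ↦ measureEntropy (κ t)]`. We use the notation `Hk[κ, μ]`.

## Main statements

* `chain_rule`: `Hk[κ, μ] = Hk[fst κ, μ] + Hk[condKernel κ, μ ⊗ₘ (fst κ)]`.
* `entropy_map_le`: data-processing inequality for the kernel entropy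

## Notations

* `Hk[κ, μ] = Kernel.entropy κ μ`

-/

open Real MeasureTheory
open scoped ENNReal NNReal Topology ProbabilityTheory

namespace ProbabilityTheory.Kernel
open Literature.Combinatorics.Additive.PFR Literature.Combinatorics.Additive.PFR.Kernel

variable {Ω S T U : Type*} [mΩ : MeasurableSpace Ω]
  [MeasurableSpace S] [MeasurableSpace T] [MeasurableSpace U]

/-- Entropy of a kernel with respect to a measure. [folklore] -/
noncomputable
def _root_.Literature.Combinatorics.Additive.PFR.Kernel.entropy (κ : Kernel T S) (μ : Measure T) := μ[fun y ↦ Hm[κ y]]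

/-- Entropy of a kernel with respect to a measure. -/
notation3:100 "Hk[" κ " , " μ "]" => Literature.Combinatorics.Additive.PFR.Kernel.entropy κ μ

/-- `_root_.Literature.Combinatorics.Additive.PFR.Kernel.entropy_zero_measure`: ported from PFR (`PFR/ForMathlib/Entropy/Kernel/Basic.lean`). [folklore] -/
@[simp]
lemma _root_.Literature.Combinatorics.Additive.PFR.Kernel.entropy_zero_measure (κ : Kernel T S) : Hk[κ, (0 : Measure T)] = 0 := by simp [entropy]

/-- `_root_.Literature.Combinatorics.Additive.PFR.Kernel.entropy_zero_kernel`: ported from PFR (`PFR/ForMathlib/Entropy/Kernel/Basic.lean`). [folklore] -/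
@[simp]
lemma _root_.Literature.Combinatorics.Additive.PFR.Kernel.entropy_zero_kernel (μ : Measure T) : Hk[(0 : Kernel T S), μ] = 0 := by simp [entropy]

/-- `_root_.Literature.Combinatorics.Additive.PFR.Kernel.entropy_congr`: ported from PFR (`PFR/ForMathlib/Entropy/Kernel/Basic.lean`). [folklore] -/
lemma _root_.Literature.Combinatorics.Additive.PFR.Kernel.entropy_congr {μ} {κ η : Kernel T S} (h : κ =ᵐ[μ] η) : Hk[κ, μ] = Hk[η, μ] := by
  simp_rw [entropy]
  refine integral_congr_ae ?_
  filter_upwards [h] with x hx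
  rw [hx]

/-- `_root_.Literature.Combinatorics.Additive.PFR.Kernel.entropy_nonneg`: ported from PFR (`PFR/ForMathlib/Entropy/Kernel/Basic.lean`). [folklore] -/
lemma _root_.Literature.Combinatorics.Additive.PFR.Kernel.entropy_nonneg (κ : Kernel T S) (μ : Measure T) :
    0 ≤ Hk[κ, μ] := integral_nonneg (fun _ ↦ measureEntropy_nonneg _)

/-- `_root_.Literature.Combinatorics.Additive.PFR.Kernel.entropy_const`: ported from PFR (`PFR/ForMathlib/Entropy/Kernel/Basic.lean`). [folklore] -/
@[simp]
lemma _root_.Literature.Combinatorics.Additive.PFR.Kernel.entropy_const (ν : Measure S) (μ : Measure T) :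
    Hk[Kernel.const T ν, μ] = (μ Set.univ).toReal * Hm[ν] := by
  simp [entropy, Measure.real]

/-- Constant kernels with finite support, have finite kernel support. [folklore] -/
lemma _root_.Literature.Combinatorics.Additive.PFR.Kernel.finiteKernelSupport_of_const (ν : Measure S) [FiniteSupport ν] :
    FiniteKernelSupport (Kernel.const T ν) := by
  intro t
  use ν.support
  simp [measure_compl_support ν]

/-- Composing a finitely supported measure with a finitely supported kernel gives a finitely
supported kernel. [folklore] -/
lemma _root_.Literature.Combinatorics.Additive.PFR.Kernel.finiteSupport_of_compProd' [MeasurableSingletonClass S] [MeasurableSingletonClass T]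
    {μ : Measure T} [IsFiniteMeasure μ] {κ : Kernel T S}
    [IsZeroOrMarkovKernel κ] [FiniteSupport μ] (hκ : FiniteKernelSupport κ) :
    FiniteSupport (μ ⊗ₘ κ) := by
  let A := μ.support
  have hA := measure_compl_support μ
  rcases (local_support_of_finiteKernelSupport hκ A) with ⟨B, hB⟩
  use A ×ˢ B
  rw [Measure.ae_compProd_iff (by exact (Finset.finite_toSet _).measurableSet)]
  filter_upwards [ae_mem_support μ] with t ht
  filter_upwards [hB t ht] with s hs
  exact Finset.mk_mem_product ht hs

/-- `_root_.Literature.Combinatorics.Additive.PFR.Kernel.finiteSupport_of_compProd`: ported from PFR (`PFR/ForMathlib/Entropy/Kernel/Basic.lean`). [folklore] -/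
lemma _root_.Literature.Combinatorics.Additive.PFR.Kernel.finiteSupport_of_compProd
    [MeasurableSingletonClass S] [Countable T] [MeasurableSingletonClass T]
    {μ : Measure T} [IsFiniteMeasure μ] {κ : Kernel T S}
    [IsZeroOrMarkovKernel κ] [FiniteSupport μ] (hκ : AEFiniteKernelSupport κ μ) :
    FiniteSupport (μ ⊗ₘ κ) := by
  rw [Measure.compProd_congr hκ.ae_eq_mk]
  exact finiteSupport_of_compProd' hκ.finiteKernelSupport_mk

/-- `_root_.Literature.Combinatorics.Additive.PFR.Kernel.aefiniteKernelSupport_condDistrib`: ported from PFR (`PFR/ForMathlib/Entropy/Kernel/Basic.lean`). [folklore] -/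
lemma _root_.Literature.Combinatorics.Additive.PFR.Kernel.aefiniteKernelSupport_condDistrib
    [Nonempty S] [Countable S] [MeasurableSingletonClass S]
    [Countable T] [MeasurableSingletonClass T]
    (X : Ω → S) (Y : Ω → T) (μ : Measure Ω) [IsFiniteMeasure μ]
    (hX : Measurable X) (hY : Measurable Y) [FiniteRange X] :
    AEFiniteKernelSupport (condDistrib X Y μ) (μ.map Y) := by
  filter_upwards [condDistrib_ae_eq hX hY μ] with a ha
  rw [ha]
  exact finiteSupport_of_finiteRange.finite

/-- `_root_.Literature.Combinatorics.Additive.PFR.Kernel.entropy_le_log_card`: ported from PFR (`PFR/ForMathlib/Entropy/Kernel/Basic.lean`). [folklore] -/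
lemma _root_.Literature.Combinatorics.Additive.PFR.Kernel.entropy_le_log_card
   [MeasurableSingletonClass S]
   (κ : Kernel T S) (μ : Measure T) [Fintype S] [IsProbabilityMeasure μ] :
    Hk[κ, μ] ≤ log (Fintype.card S) := by
  refine (integral_mono_of_nonneg ?_ (integrable_const (log (Fintype.card S))) ?_).trans ?_
  · exact ae_of_all _ (fun _ ↦ measureEntropy_nonneg _)
  · exact ae_of_all _ (fun _ ↦ measureEntropy_le_log_card _)
  · simp

/-- `_root_.Literature.Combinatorics.Additive.PFR.Kernel.entropy_eq_integral_sum`: ported from PFR (`PFR/ForMathlib/Entropy/Kernel/Basic.lean`). [folklore] -/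
lemma _root_.Literature.Combinatorics.Additive.PFR.Kernel.entropy_eq_integral_sum (κ : Kernel T S) [IsZeroOrMarkovKernel κ] (μ : Measure T) :
    Hk[κ, μ] = μ[fun y ↦ ∑' x, negMulLog ((κ y).real {x})] := by
  simp_rw [entropy, measureEntropy_of_isProbabilityMeasure]

/-- `_root_.Literature.Combinatorics.Additive.PFR.Kernel.entropy_snd_compProd_deterministic_of_injective`: ported from PFR (`PFR/ForMathlib/Entropy/Kernel/Basic.lean`). [folklore] -/
-- entropy_map_of_injective is a special case of this (see def of map)
lemma _root_.Literature.Combinatorics.Additive.PFR.Kernel.entropy_snd_compProd_deterministic_of_injective [MeasurableSingletonClass U]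
    (κ : Kernel T S) [IsMarkovKernel κ]
    (μ : Measure T) {f : T × S → U}
    (hf : ∀ t, Function.Injective (fun x ↦ f (t, x))) (hmes : Measurable f) :
    Hk[snd (κ ⊗ₖ deterministic f hmes), μ] = Hk[κ, μ] := by
  have : ∀ t, snd (κ ⊗ₖ deterministic f hmes) t
      = map κ (fun x ↦ f (t, x)) t := by
    intro t
    ext s hs
    rw [snd_apply' _ _ hs, compProd_deterministic_apply, map_apply' _ (by fun_prop) _ hs]
    · rfl
    · exact measurable_snd hs
  simp_rw [entropy]
  congr with y
  convert measureEntropy_map_of_injective (κ y) _ (hmes.comp measurable_prodMk_left) (hf y)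
  rw [this y, map_apply _ (by fun_prop)]
  rfl

/-- `_root_.Literature.Combinatorics.Additive.PFR.Kernel.entropy_map_of_injective`: ported from PFR (`PFR/ForMathlib/Entropy/Kernel/Basic.lean`). [folklore] -/
lemma _root_.Literature.Combinatorics.Additive.PFR.Kernel.entropy_map_of_injective [MeasurableSingletonClass U]
    (κ : Kernel T S) (μ : Measure T) {f : S → U} (hf : Function.Injective f) (hmes : Measurable f) :
    Hk[map κ f, μ] = Hk[κ, μ] := by
  simp_rw [entropy, map_apply _ hmes, measureEntropy_map_of_injective _ _ hmes hf]

/-- `_root_.Literature.Combinatorics.Additive.PFR.Kernel.entropy_map_swap`: ported from PFR (`PFR/ForMathlib/Entropy/Kernel/Basic.lean`). [folklore] -/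
lemma _root_.Literature.Combinatorics.Additive.PFR.Kernel.entropy_map_swap [MeasurableSingletonClass S] [MeasurableSingletonClass U]
    (κ : Kernel T (S × U)) (μ : Measure T) :
    Hk[map κ Prod.swap, μ] = Hk[κ, μ] :=
  entropy_map_of_injective κ μ Prod.swap_injective measurable_swap

/-- `_root_.Literature.Combinatorics.Additive.PFR.Kernel.entropy_swapRight`: ported from PFR (`PFR/ForMathlib/Entropy/Kernel/Basic.lean`). [folklore] -/
lemma _root_.Literature.Combinatorics.Additive.PFR.Kernel.entropy_swapRight [MeasurableSingletonClass S] [MeasurableSingletonClass U]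
    (κ : Kernel T (S × U)) (μ : Measure T) :
    Hk[swapRight κ, μ] = Hk[κ, μ] := by
  rw [swapRight_eq, entropy_map_swap]

/-- `_root_.Literature.Combinatorics.Additive.PFR.Kernel.entropy_comap`: ported from PFR (`PFR/ForMathlib/Entropy/Kernel/Basic.lean`). [folklore] -/
lemma _root_.Literature.Combinatorics.Additive.PFR.Kernel.entropy_comap [MeasurableSingletonClass T]
    {T' : Type*} [MeasurableSpace T'] [MeasurableSingletonClass T']
    (κ : Kernel T S) (μ : Measure T) (f : T' → T) (hf : MeasurableEmbedding f)
    (hf_range : Set.range f =ᵐ[μ] Set.univ)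
    [IsFiniteMeasure μ] [IsFiniteMeasure (μ.comap f)] (hfμ : FiniteSupport (μ.comap f)) :
    Hk[comap κ f hf.measurable, μ.comap f] = Hk[κ, μ] := by
  classical
  rcases hfμ with ⟨A, (hA : ∀ᵐ x ∂μ.comap f, x ∈ A)⟩
  have : ∀ᵐ x ∂μ, x ∈ Finset.image f A := by
    change μ (Finset.image f A : Set T)ᶜ = 0
    simp only [Finset.coe_image, hf.injective.compl_image_eq, measure_union_null_iff]
    constructor
    · rwa [← Measure.comap_apply f hf.injective hf.measurableSet_image']
      exact MeasurableSet.compl (Finset.measurableSet A)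
    exact ae_eq_univ.mp hf_range
  simp_rw [entropy]
  simp_rw [integral_eq_setIntegral hA, integral_eq_setIntegral this,
    setIntegral_finset _ .finset,
    Measure.comap_real_apply hf.injective hf.measurableSet_image' _ (.singleton _)]
  simp only [Set.image_singleton, smul_eq_mul]
  simp_rw [comap_apply]
  rw [← Finset.sum_image (f := fun x ↦ μ.real {x} * measureEntropy (κ x)) (g := f)]
  intro x _ y _ hxy
  exact hf.injective hxy

/-- `_root_.Literature.Combinatorics.Additive.PFR.Kernel.FiniteSupport.comap_equiv`: ported from PFR (`PFR/ForMathlib/Entropy/Kernel/Basic.lean`). [folklore] -/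
lemma _root_.Literature.Combinatorics.Additive.PFR.Kernel.FiniteSupport.comap_equiv [MeasurableSingletonClass T]
    {T' : Type*} [MeasurableSpace T']
    {μ : Measure T} (f : T' ≃ᵐ T) [FiniteSupport μ] :
    FiniteSupport (μ.comap f) := by
  classical
  let A := μ.support
  have hA := measure_compl_support μ
  refine ⟨Finset.image f.symm A, ?_⟩
  change (Measure.comap (⇑f) μ) (A.image f.symm)ᶜ = 0
  rwa [Finset.coe_image, ← Set.image_compl_eq (MeasurableEquiv.bijective f.symm),
    Measure.comap_apply f (MeasurableEquiv.injective f),MeasurableEquiv.image_symm,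
    MeasurableEquiv.image_preimage]
  · exact fun _ ↦ (MeasurableEquiv.measurableSet_image f).mpr
  · exact f.symm.measurableSet_image.mpr A.measurableSet.compl

/-- `_root_.Literature.Combinatorics.Additive.PFR.Kernel.entropy_comap_equiv`: ported from PFR (`PFR/ForMathlib/Entropy/Kernel/Basic.lean`). [folklore] -/
lemma _root_.Literature.Combinatorics.Additive.PFR.Kernel.entropy_comap_equiv [MeasurableSingletonClass T]
    {T' : Type*} [MeasurableSpace T'] [MeasurableSingletonClass T']
    (κ : Kernel T S) {μ : Measure T} (f : T' ≃ᵐ T)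
    [IsFiniteMeasure μ] [FiniteSupport μ] :
    Hk[comap κ f f.measurable, μ.comap f] = Hk[κ, μ] := by
  rw [entropy_comap]
  · exact f.measurableEmbedding
  · rw [← MeasurableEquiv.coe_toEquiv, Equiv.range_eq_univ]
  · exact FiniteSupport.comap_equiv f

/-- `_root_.Literature.Combinatorics.Additive.PFR.Kernel.entropy_comap_swap`: ported from PFR (`PFR/ForMathlib/Entropy/Kernel/Basic.lean`). [folklore] -/
lemma _root_.Literature.Combinatorics.Additive.PFR.Kernel.entropy_comap_swap [MeasurableSingletonClass T]
    {T' : Type*} [MeasurableSpace T'] [MeasurableSingletonClass T']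
    (κ : Kernel (T' × T) S) {μ : Measure (T' × T)} [IsFiniteMeasure μ] [FiniteSupport μ] :
    Hk[comap κ Prod.swap measurable_swap, μ.comap Prod.swap] = Hk[κ, μ] :=
  entropy_comap_equiv κ MeasurableEquiv.prodComm

/-- `_root_.Literature.Combinatorics.Additive.PFR.Kernel.entropy_prodMkLeft_unit`: ported from PFR (`PFR/ForMathlib/Entropy/Kernel/Basic.lean`). [folklore] -/
lemma _root_.Literature.Combinatorics.Additive.PFR.Kernel.entropy_prodMkLeft_unit [MeasurableSingletonClass T]
    (κ : Kernel T S) {μ : Measure T} [IsZeroOrProbabilityMeasure μ] [FiniteSupport μ] :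
    Hk[prodMkLeft Unit κ, μ.map (Prod.mk ())] = Hk[κ, μ] := by
  convert entropy_comap_equiv κ (.punitProd) (μ := μ)
  · rfl
  rw [← MeasurableEquiv.map_symm]
  congr

/-- `_root_.Literature.Combinatorics.Additive.PFR.Kernel.entropy_compProd_aux`: ported from PFR (`PFR/ForMathlib/Entropy/Kernel/Basic.lean`). [folklore] -/
lemma _root_.Literature.Combinatorics.Additive.PFR.Kernel.entropy_compProd_aux [MeasurableSingletonClass S] [MeasurableSingletonClass T]
    [MeasurableSingletonClass U] {μ} [IsFiniteMeasure μ] {κ : Kernel T S} [IsZeroOrMarkovKernel κ]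
    {η : Kernel (T × S) U} [IsMarkovKernel η] [FiniteSupport μ] (hκ : FiniteKernelSupport κ)
    (hη : FiniteKernelSupport η) :
    Hk[κ ⊗ₖ η, μ] = Hk[κ, μ]
      + μ[fun t ↦ Hk[comap η (Prod.mk t) measurable_prodMk_left, (κ t)]] := by
  rcases eq_zero_or_isMarkovKernel κ with rfl | hκ'
  · simp
  let A := μ.support
  have hsum (F : T → ℝ) : ∫ (t : T), F t ∂μ = ∑ t ∈ A, (μ.real {t}) * (F t) := by
    rw [integral_eq_setIntegral (ae_mem_support μ), setIntegral_finset _ .finset]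
    congr with t ht
  simp_rw [entropy, hsum, ← Finset.sum_add_distrib]
  apply Finset.sum_congr rfl
  intro t ht
  rw [← mul_add]
  congr
  obtain ⟨B, hB⟩ := local_support_of_finiteKernelSupport hκ A
  obtain ⟨C, hC⟩ := local_support_of_finiteKernelSupport hη (A ×ˢ B)
  rw [integral_eq_setIntegral (hB t ht)]
  have hκη : ((κ ⊗ₖ η) t) (B ×ˢ C : Finset (S × U))ᶜ = 0 := by
    rw [Kernel.compProd_apply (Finset.measurableSet _).compl,
      lintegral_eq_setLIntegral (ae_iff.1 <| hB t ht), setLIntegral_eq_sum]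
    apply Finset.sum_eq_zero
    intro s hs
    simpa using .inr <| measure_mono_null (by simp [*]) (hC (t, s) <| by simp [ht, hs])
  rw [measureEntropy_eq_sum hκη, measureEntropy_eq_sum (hB t ht),
    setIntegral_finset _ .finset,
    ← Finset.sum_add_distrib, Finset.sum_product]
  apply Finset.sum_congr rfl
  intro s hs
  simp only [measure_univ, inv_one, one_smul, coe_comap, Function.comp_apply, smul_eq_mul]
  have hts : (t, s) ∈ A ×ˢ B := by simp [ht, hs]
  rw [measureEntropy_eq_sum (hC (t, s) hts)]
  simp only [measure_univ, inv_one, one_smul]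
  have : negMulLog ((κ t).real {s}) = ∑ u ∈ C, negMulLog ((κ t).real {s}) *
      ((comap η (Prod.mk t) measurable_prodMk_left) s).real {u} := by
    rw [← Finset.mul_sum]
    simp only [coe_comap, Function.comp_apply, sum_measureReal_singleton]
    suffices (η (t, s)).real ↑C = (η (t, s)).real Set.univ by simp [this]
    have := hC (t, s) hts
    rw [ae_iff, ← measureReal_eq_zero_iff] at this
    change (η (t, s)).real Cᶜ = 0 at this
    rw [← measureReal_add_measureReal_compl (s := C) _, this, add_zero]
    exact Finset.measurableSet C
  rw [this, Finset.mul_sum, ← Finset.sum_add_distrib]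
  congr with u
  have : ((κ ⊗ₖ η) t).real {(s, u)} = (κ t).real {s} * (η (t, s)).real {u} := by
    rw [measureReal_def, compProd_apply (.singleton _),
      lintegral_eq_setLIntegral (ae_iff.1 <| hB t ht), setLIntegral_eq_sum,
      Finset.sum_eq_single_of_mem s hs]
    · simp [measureReal_def, Set.preimage]
    intro b _ hbs
    simp [hbs, Set.preimage]
  rw [this, Kernel.comap_apply, negMulLog_mul, negMulLog, negMulLog]
  ring

/-- `_root_.Literature.Combinatorics.Additive.PFR.Kernel.entropy_compProd'`: ported from PFR (`PFR/ForMathlib/Entropy/Kernel/Basic.lean`). [folklore] -/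
lemma _root_.Literature.Combinatorics.Additive.PFR.Kernel.entropy_compProd' [MeasurableSingletonClass S] [Countable S] [MeasurableSingletonClass T]
    [Countable T] [MeasurableSingletonClass U] {μ}
    [IsFiniteMeasure μ] {κ : Kernel T S} [IsZeroOrMarkovKernel κ]
    {η : Kernel (T × S) U} [IsMarkovKernel η] [FiniteSupport μ]
    (hκ : FiniteKernelSupport κ) (hη : FiniteKernelSupport η) :
    Hk[κ ⊗ₖ η, μ] = Hk[κ, μ] + Hk[η, μ ⊗ₘ κ] := by
  rw [entropy_compProd_aux hκ hη]
  congr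
  rw [entropy, Measure.integral_compProd]
  · simp_rw [entropy]
    congr
  · have := finiteSupport_of_compProd' hκ (μ := μ)
    exact integrable_of_finiteSupport (μ ⊗ₘ κ)

/-- `_root_.Literature.Combinatorics.Additive.PFR.Kernel.entropy_compProd`: ported from PFR (`PFR/ForMathlib/Entropy/Kernel/Basic.lean`). [folklore] -/
lemma _root_.Literature.Combinatorics.Additive.PFR.Kernel.entropy_compProd [Countable S] [MeasurableSingletonClass S]
    [Countable T] [MeasurableSingletonClass T] [MeasurableSingletonClass U] {μ}
    [IsFiniteMeasure μ] {κ : Kernel T S} [IsZeroOrMarkovKernel κ]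
    {η : Kernel (T × S) U} [IsMarkovKernel η] [FiniteSupport μ]
    (hκ : AEFiniteKernelSupport κ μ) (hη : AEFiniteKernelSupport η (μ ⊗ₘ κ)) :
    Hk[κ ⊗ₖ η, μ] = Hk[κ, μ] + Hk[η, μ ⊗ₘ κ] := by
  have h_meas_eq : μ ⊗ₘ hκ.mk = μ ⊗ₘ κ := Measure.compProd_congr hκ.ae_eq_mk.symm
  have h_ent1 : Hk[hκ.mk ⊗ₖ hη.mk, μ] = Hk[κ ⊗ₖ η, μ] := by
    refine entropy_congr <| compProd_congr_ae hκ.ae_eq_mk.symm ?_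
    convert hη.ae_eq_mk.symm
  have h_ent2 : Hk[hκ.mk, μ] = Hk[κ, μ] := entropy_congr hκ.ae_eq_mk.symm
  have h_ent3 : Hk[hη.mk, μ ⊗ₘ hκ.mk] = Hk[η, μ ⊗ₘ κ] := by
    rw [h_meas_eq, entropy_congr hη.ae_eq_mk]
  rw [← h_ent1, ← h_ent2, ← h_ent3,
    entropy_compProd' hκ.finiteKernelSupport_mk hη.finiteKernelSupport_mk]

/-- `_root_.Literature.Combinatorics.Additive.PFR.Kernel.entropy_deterministic`: ported from PFR (`PFR/ForMathlib/Entropy/Kernel/Basic.lean`). [folklore] -/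
@[simp]
lemma _root_.Literature.Combinatorics.Additive.PFR.Kernel.entropy_deterministic [MeasurableSingletonClass S]
    [Countable T] [MeasurableSingletonClass T] (f : T → S) (μ : Measure T) :
    Hk[deterministic f .of_discrete, μ] = 0 := by
  simp_rw [entropy]
  convert integral_zero T ℝ
  apply measureEntropy_dirac

/-- `_root_.Literature.Combinatorics.Additive.PFR.Kernel.entropy_compProd_deterministic`: ported from PFR (`PFR/ForMathlib/Entropy/Kernel/Basic.lean`). [folklore] -/
@[simp]
lemma _root_.Literature.Combinatorics.Additive.PFR.Kernel.entropy_compProd_deterministic [Countable S] [MeasurableSingletonClass S]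
    [Countable T] [MeasurableSingletonClass T] [MeasurableSingletonClass U]
    (κ : Kernel T S) [IsZeroOrMarkovKernel κ] (μ : Measure T) [IsFiniteMeasure μ] (f : T × S → U)
    [FiniteSupport μ] (hκ : AEFiniteKernelSupport κ μ) :
    Hk[κ ⊗ₖ (deterministic f .of_discrete), μ] = Hk[κ, μ] := by
  simp [entropy_compProd hκ ((FiniteKernelSupport.deterministic f).aefiniteKernelSupport _)]

/-- `_root_.Literature.Combinatorics.Additive.PFR.Kernel.nonempty_of_isMarkovKernel`: ported from PFR (`PFR/ForMathlib/Entropy/Kernel/Basic.lean`). [folklore] -/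
lemma _root_.Literature.Combinatorics.Additive.PFR.Kernel.nonempty_of_isMarkovKernel {α β : Type*} [MeasurableSpace α] [MeasurableSpace β]
    (κ : Kernel α β) [IsMarkovKernel κ] [Nonempty α] : Nonempty β :=
  (κ <| Classical.arbitrary _).nonempty_of_neZero

/-- `_root_.Literature.Combinatorics.Additive.PFR.Kernel.nonempty_of_isProbabilityMeasure_of_isMarkovKernel`: ported from PFR (`PFR/ForMathlib/Entropy/Kernel/Basic.lean`). [folklore] -/
lemma _root_.Literature.Combinatorics.Additive.PFR.Kernel.nonempty_of_isProbabilityMeasure_of_isMarkovKernel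
    {α β : Type*} [MeasurableSpace α] [MeasurableSpace β] (μ : Measure α) [IsProbabilityMeasure μ]
    (κ : Kernel α β) [IsMarkovKernel κ] : Nonempty β := by
  have : Nonempty α := μ.nonempty_of_neZero
  exact nonempty_of_isMarkovKernel κ

/-- `_root_.Literature.Combinatorics.Additive.PFR.Kernel.chain_rule`: ported from PFR (`PFR/ForMathlib/Entropy/Kernel/Basic.lean`). [folklore] -/
lemma _root_.Literature.Combinatorics.Additive.PFR.Kernel.chain_rule [Countable S] [MeasurableSingletonClass S] [Countable T]
    [MeasurableSingletonClass T] [Countable U] [MeasurableSingletonClass U]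
    {κ : Kernel T (S × U)} [IsZeroOrMarkovKernel κ] [hU : Nonempty U]
    {μ : Measure T} [IsZeroOrProbabilityMeasure μ] [FiniteSupport μ]
    (hκ : AEFiniteKernelSupport κ μ) :
    Hk[κ, μ] = Hk[fst κ, μ] + Hk[condKernel κ, μ ⊗ₘ (fst κ)] := by
  conv_lhs => rw [disintegration κ]
  rw [entropy_compProd hκ.fst (aefiniteKernelSupport_of_cond _ hκ)]

/-- `_root_.Literature.Combinatorics.Additive.PFR.Kernel.chain_rule'`: ported from PFR (`PFR/ForMathlib/Entropy/Kernel/Basic.lean`). [folklore] -/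
lemma _root_.Literature.Combinatorics.Additive.PFR.Kernel.chain_rule' [Nonempty S] [Countable S] [MeasurableSingletonClass S] [Countable T]
    [MeasurableSingletonClass T] [Countable U] [MeasurableSingletonClass U]
    {κ : Kernel T (S × U)} [IsZeroOrMarkovKernel κ]
    {μ : Measure T} [IsZeroOrProbabilityMeasure μ] [FiniteSupport μ]
    (hκ : AEFiniteKernelSupport κ μ) :
    Hk[κ, μ] = Hk[snd κ, μ] + Hk[condKernel (swapRight κ), μ ⊗ₘ (snd κ)] := by
  rw [← entropy_swapRight, chain_rule hκ.swapRight]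
  simp

/-- `_root_.Literature.Combinatorics.Additive.PFR.Kernel.entropy_prodMkRight`: ported from PFR (`PFR/ForMathlib/Entropy/Kernel/Basic.lean`). [folklore] -/
@[simp]
lemma _root_.Literature.Combinatorics.Additive.PFR.Kernel.entropy_prodMkRight [Countable S] [MeasurableSingletonClass S] [Countable T]
    [MeasurableSingletonClass T]
    {κ : Kernel T S} {η : Kernel T U}
    [IsMarkovKernel κ] {μ : Measure T} [IsZeroOrProbabilityMeasure μ] [FiniteSupport μ]
    (hκ : AEFiniteKernelSupport κ μ) :
    Hk[prodMkRight S η, μ ⊗ₘ κ] = Hk[η, μ] := by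
  have := finiteSupport_of_compProd hκ (μ := μ)
  simp [entropy, Measure.integral_compProd, integrable_of_finiteSupport]

/-- `_root_.Literature.Combinatorics.Additive.PFR.Kernel.entropy_prodMkRight'`: ported from PFR (`PFR/ForMathlib/Entropy/Kernel/Basic.lean`). [folklore] -/
lemma _root_.Literature.Combinatorics.Additive.PFR.Kernel.entropy_prodMkRight' [Countable S] [MeasurableSingletonClass S] [Countable T]
    [MeasurableSingletonClass T]
    {η : Kernel T U}
    {μ : Measure T} [IsZeroOrProbabilityMeasure μ] {ν : Measure S} [IsProbabilityMeasure ν]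
    [FiniteSupport μ] [FiniteSupport ν] :
    Hk[prodMkRight S η, μ.prod ν] = Hk[η, μ] := by
  rw [← entropy_prodMkRight (μ := μ) ((finiteKernelSupport_of_const ν).aefiniteKernelSupport _)]
  congr
  ext s hs
  simp_rw [Measure.prod_apply hs, Measure.compProd_apply hs, Kernel.const_apply]

/-- `_root_.Literature.Combinatorics.Additive.PFR.Kernel.entropy_prodMkLeft`: ported from PFR (`PFR/ForMathlib/Entropy/Kernel/Basic.lean`). [folklore] -/
@[simp]
lemma _root_.Literature.Combinatorics.Additive.PFR.Kernel.entropy_prodMkLeft [Countable S] [MeasurableSingletonClass S] [Countable T]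
    [MeasurableSingletonClass T] {η : Kernel T U}
    {ν : Measure S} [IsProbabilityMeasure ν] {μ : Measure T} [IsZeroOrProbabilityMeasure μ]
    [FiniteSupport μ] [FiniteSupport ν] :
    Hk[prodMkLeft S η, ν.prod μ] = Hk[η, μ] := by
  simp_rw [entropy, prodMkLeft_apply]
  rw [integral_prod]
  swap; · exact integrable_of_finiteSupport (ν.prod μ)
  simp

variable [Countable S] [MeasurableSingletonClass S] [Countable T]
    [MeasurableSingletonClass T] [Countable U] [MeasurableSingletonClass U]

/-- `_root_.Literature.Combinatorics.Additive.PFR.Kernel.entropy_prod`: ported from PFR (`PFR/ForMathlib/Entropy/Kernel/Basic.lean`). [folklore] -/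
@[simp]
lemma _root_.Literature.Combinatorics.Additive.PFR.Kernel.entropy_prod {κ : Kernel T S} {η : Kernel T U} [IsMarkovKernel κ] [IsMarkovKernel η]
    {μ : Measure T} [IsZeroOrProbabilityMeasure μ] [FiniteSupport μ]
    (hκ : AEFiniteKernelSupport κ μ) (hη : AEFiniteKernelSupport η μ) :
    Hk[κ ×ₖ η, μ] = Hk[κ, μ] + Hk[η, μ] := by
  rcases eq_zero_or_isProbabilityMeasure μ with rfl | hμ
  · simp
  have : Nonempty U := nonempty_of_isProbabilityMeasure_of_isMarkovKernel μ η
  rw [chain_rule (hκ.prod hη), fst_prod,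
    entropy_congr (condKernel_prod_ae_eq _ _), entropy_prodMkRight hκ]

/-- Data-processing inequality for the kernel entropy. [folklore] -/
lemma _root_.Literature.Combinatorics.Additive.PFR.Kernel.entropy_map_le
    {κ : Kernel T S} [IsZeroOrMarkovKernel κ] {μ : Measure T} [IsZeroOrProbabilityMeasure μ]
    (f : S → U) [FiniteSupport μ] (hκ : AEFiniteKernelSupport κ μ) :
    Hk[map κ f, μ] ≤ Hk[κ, μ] := by
  rcases eq_zero_or_isMarkovKernel κ with rfl | hκ'
  · simp
  rcases eq_zero_or_isProbabilityMeasure μ with rfl | hμ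
  · simp
  have : Nonempty S := nonempty_of_isProbabilityMeasure_of_isMarkovKernel μ κ
  have : Hk[κ, μ] = Hk[map κ (fun x ↦ (x, f x)), μ] := by
    refine (entropy_map_of_injective κ μ (f := fun x ↦ (x, f x)) ?_ (by fun_prop)).symm
    intro x y hxy
    simp only [Prod.mk.injEq] at hxy
    exact hxy.1
  rw [this, chain_rule' hκ.map]
  simp_rw [snd_map_prod κ measurable_id', le_add_iff_nonneg_right]
  exact entropy_nonneg _ _

/-- `_root_.Literature.Combinatorics.Additive.PFR.Kernel.entropy_of_map_eq_of_map`: ported from PFR (`PFR/ForMathlib/Entropy/Kernel/Basic.lean`). [folklore] -/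
lemma _root_.Literature.Combinatorics.Additive.PFR.Kernel.entropy_of_map_eq_of_map {κ : Kernel T S} {η : Kernel T U}
    [IsZeroOrMarkovKernel κ] [IsZeroOrMarkovKernel η]
    {μ : Measure T} [IsZeroOrProbabilityMeasure μ] (f : S → U) (g : U → S)
    (h1 : η = map κ f) (h2 : κ = map η g)
    [FiniteSupport μ] (hκ : AEFiniteKernelSupport κ μ) (hη : AEFiniteKernelSupport η μ) :
    Hk[κ, μ] = Hk[η, μ] := by
  refine le_antisymm ?_ ?_
  · rw [h2]; exact entropy_map_le g hη
  · rw [h1]; exact entropy_map_le f hκ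

/-- `_root_.Literature.Combinatorics.Additive.PFR.Kernel.entropy_snd_le`: ported from PFR (`PFR/ForMathlib/Entropy/Kernel/Basic.lean`). [folklore] -/
lemma _root_.Literature.Combinatorics.Additive.PFR.Kernel.entropy_snd_le {κ : Kernel T (S × U)} [IsZeroOrMarkovKernel κ]
    {μ : Measure T} [IsZeroOrProbabilityMeasure μ]
    [FiniteSupport μ] (hκ : AEFiniteKernelSupport κ μ) :
    Hk[snd κ, μ] ≤ Hk[κ, μ] := by
  rw [snd_eq]
  exact entropy_map_le _ hκ

/-- `_root_.Literature.Combinatorics.Additive.PFR.Kernel.entropy_fst_le`: ported from PFR (`PFR/ForMathlib/Entropy/Kernel/Basic.lean`). [folklore] -/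
lemma _root_.Literature.Combinatorics.Additive.PFR.Kernel.entropy_fst_le (κ : Kernel T (S × U)) [IsZeroOrMarkovKernel κ]
    (μ : Measure T) [IsZeroOrProbabilityMeasure μ]
    [FiniteSupport μ] (hκ : AEFiniteKernelSupport κ μ) :
    Hk[fst κ, μ] ≤ Hk[κ, μ] := by
  rw [fst_eq]
  exact entropy_map_le _ hκ

end ProbabilityTheory.Kernel

end PFR_ForMathlib_Entropy_Kernel_Basic

/-! ## Port of `PFR/ForMathlib/Entropy/Kernel/MutualInfo.lean` -/
section PFR_ForMathlib_Entropy_Kernel_MutualInfo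
/-!
# Mutual Information of kernels

## Main definitions

* `mutualInfo`: Mutual information of a kernel `κ` into a product space with respect to a
  measure `μ`. This is denoted by `Ik[κ, μ]` and is equal to
  `Hk[fst κ, μ] + Hk[snd κ, μ] - Hk[κ, μ]`.

## Main statements

* `mutualInfo_nonneg`: `Ik[κ, μ]` is nonnegative
* `entropy_condKernel_le_entropy_fst` and `entropy_condKernel_le_entropy_snd`: conditioning
  reduces entropy.

## Notations

* `Ik[κ, μ] = Kernel.entropy κ μ`

-/

open Function MeasureTheory Real
open scoped ENNReal NNReal Topology ProbabilityTheory

namespace ProbabilityTheory.Kernel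
open Literature.Combinatorics.Additive.PFR Literature.Combinatorics.Additive.PFR.Kernel

variable {Ω S T U V : Type*} [mΩ : MeasurableSpace Ω]
  [MeasurableSpace S] [MeasurableSpace T] [MeasurableSpace U] [MeasurableSpace V]
  {κ : Kernel T S} {μ : Measure T} {X : Ω → S} {Y : Ω → U}

/-- Mutual information of a kernel into a product space with respect to a measure. [folklore] -/
noncomputable
def _root_.Literature.Combinatorics.Additive.PFR.Kernel.mutualInfo (κ : Kernel T (S × U)) (μ : Measure T) : ℝ :=
  Hk[fst κ, μ] + Hk[snd κ, μ] - Hk[κ, μ]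

/-- Mutual information of a kernel into a product space with respect to a measure. -/
notation3:100 "Ik[" κ " , " μ "]" => Kernel.mutualInfo κ μ

/-- `_root_.Literature.Combinatorics.Additive.PFR.Kernel.mutualInfo_def`: ported from PFR (`PFR/ForMathlib/Entropy/Kernel/MutualInfo.lean`). [folklore] -/
lemma _root_.Literature.Combinatorics.Additive.PFR.Kernel.mutualInfo_def (κ : Kernel T (S × U)) (μ : Measure T) :
    Ik[κ, μ] = Hk[fst κ, μ] + Hk[snd κ, μ] - Hk[κ, μ] := rfl

/-- `_root_.Literature.Combinatorics.Additive.PFR.Kernel.mutualInfo_zero_measure`: ported from PFR (`PFR/ForMathlib/Entropy/Kernel/MutualInfo.lean`). [folklore] -/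
@[simp]
lemma _root_.Literature.Combinatorics.Additive.PFR.Kernel.mutualInfo_zero_measure (κ : Kernel T (S × U)) : Ik[κ, (0 : Measure T)] = 0 := by
  simp [mutualInfo]

/-- `_root_.Literature.Combinatorics.Additive.PFR.Kernel.mutualInfo_zero_kernel`: ported from PFR (`PFR/ForMathlib/Entropy/Kernel/MutualInfo.lean`). [folklore] -/
@[simp]
lemma _root_.Literature.Combinatorics.Additive.PFR.Kernel.mutualInfo_zero_kernel (μ : Measure T) : Ik[(0 : Kernel T (S × U)), μ] = 0 := by
  simp [mutualInfo]

/-- `_root_.Literature.Combinatorics.Additive.PFR.Kernel.mutualInfo_congr`: ported from PFR (`PFR/ForMathlib/Entropy/Kernel/MutualInfo.lean`). [folklore] -/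
lemma _root_.Literature.Combinatorics.Additive.PFR.Kernel.mutualInfo_congr {κ η : Kernel T (S × U)} {μ : Measure T} (h : κ =ᵐ[μ] η) :
    Ik[κ, μ] = Ik[η, μ] := by
  rw [mutualInfo, mutualInfo]
  have h1 : fst κ =ᵐ[μ] fst η := by
    filter_upwards [h] with t ht
    rw [fst_apply, ht, fst_apply]
  have h2 : snd κ =ᵐ[μ] snd η := by
    filter_upwards [h] with t ht
    rw [snd_apply, ht, snd_apply]
  rw [entropy_congr h1, entropy_congr h2, entropy_congr h]

/-- `_root_.Literature.Combinatorics.Additive.PFR.Kernel.compProd_assoc'`: ported from PFR (`PFR/ForMathlib/Entropy/Kernel/MutualInfo.lean`). [folklore] -/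
lemma _root_.Literature.Combinatorics.Additive.PFR.Kernel.compProd_assoc' (ξ : Kernel T S) [IsSFiniteKernel ξ]
    (κ : Kernel (T × S) U) [IsSFiniteKernel κ] (η : Kernel (T × S × U) V) [IsSFiniteKernel η] :
    map ((ξ ⊗ₖ κ) ⊗ₖ η) MeasurableEquiv.prodAssoc
      = ξ ⊗ₖ (κ ⊗ₖ (comap η MeasurableEquiv.prodAssoc MeasurableEquiv.prodAssoc.measurable)) := by
  ext x s hs
  rw [map_apply' _ (by fun_prop) _ hs,
    compProd_apply (MeasurableEquiv.prodAssoc.measurable hs),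
    compProd_apply hs, lintegral_compProd]
  swap; · exact measurable_kernel_prodMk_left' (MeasurableEquiv.prodAssoc.measurable hs) _
  congr with a
  rw [compProd_apply]
  swap; · exact measurable_prodMk_left hs
  congr

/-- `_root_.Literature.Combinatorics.Additive.PFR.Kernel.Measure.compProd_compProd`: ported from PFR (`PFR/ForMathlib/Entropy/Kernel/MutualInfo.lean`). [folklore] -/
lemma _root_.Literature.Combinatorics.Additive.PFR.Kernel.Measure.compProd_compProd (μ : Measure T)
    (ξ : Kernel T S) [IsSFiniteKernel ξ] (κ : Kernel (T × S) U) [IsSFiniteKernel κ] :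
    μ ⊗ₘ (ξ ⊗ₖ κ) = (μ ⊗ₘ ξ ⊗ₘ κ).map MeasurableEquiv.prodAssoc := by
  by_cases hμ : SFinite μ; swap
  · simp [Measure.compProd_of_not_sfinite _ _ hμ]
  ext s hs
  rw [Measure.compProd_apply hs, Measure.map_apply MeasurableEquiv.prodAssoc.measurable hs,
    Measure.compProd_apply (MeasurableEquiv.prodAssoc.measurable hs),
    Measure.lintegral_compProd]
  swap; · exact measurable_kernel_prodMk_left (MeasurableEquiv.prodAssoc.measurable hs)
  congr with a
  rw [compProd_apply (measurable_prodMk_left hs)]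
  congr

/-- `_root_.Literature.Combinatorics.Additive.PFR.Kernel.Measure.compProd_compProd'`: ported from PFR (`PFR/ForMathlib/Entropy/Kernel/MutualInfo.lean`). [folklore] -/
lemma _root_.Literature.Combinatorics.Additive.PFR.Kernel.Measure.compProd_compProd' (μ : Measure T)
    (ξ : Kernel T S) [IsSFiniteKernel ξ] (κ : Kernel (T × S) U) [IsSFiniteKernel κ] :
    μ ⊗ₘ (ξ ⊗ₖ κ) = (μ ⊗ₘ ξ ⊗ₘ κ).comap
      (MeasurableEquiv.prodAssoc.symm : T × S × U ≃ᵐ (T × S) × U) := by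
  rw [MeasurableEquiv.comap_symm, Measure.compProd_compProd]

/-- `_root_.Literature.Combinatorics.Additive.PFR.Kernel.Measure.compProd_compProd''`: ported from PFR (`PFR/ForMathlib/Entropy/Kernel/MutualInfo.lean`). [folklore] -/
lemma _root_.Literature.Combinatorics.Additive.PFR.Kernel.Measure.compProd_compProd'' (μ : Measure T)
    (ξ : Kernel T S) [IsSFiniteKernel ξ] (κ : Kernel (T × S) U) [IsSFiniteKernel κ] :
    μ ⊗ₘ ξ ⊗ₘ κ = Measure.comap MeasurableEquiv.prodAssoc (μ ⊗ₘ (ξ ⊗ₖ κ)) := by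
  rw [Measure.compProd_compProd, ← MeasurableEquiv.map_symm, Measure.map_map]
  · simp
  · exact MeasurableEquiv.prodAssoc.symm.measurable
  · exact MeasurableEquiv.prodAssoc.measurable

section

variable [MeasurableSingletonClass S] [MeasurableSingletonClass U]

/-- `_root_.Literature.Combinatorics.Additive.PFR.Kernel.mutualInfo_swapRight`: ported from PFR (`PFR/ForMathlib/Entropy/Kernel/MutualInfo.lean`). [folklore] -/
@[simp]
lemma _root_.Literature.Combinatorics.Additive.PFR.Kernel.mutualInfo_swapRight
    (κ : Kernel T (S × U)) (μ : Measure T) :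
    Ik[swapRight κ, μ] = Ik[κ, μ] := by
  rw [mutualInfo, fst_swapRight, snd_swapRight, entropy_swapRight, add_comm]
  rfl

variable [MeasurableSingletonClass T]

/-- `_root_.Literature.Combinatorics.Additive.PFR.Kernel.mutualInfo_nonneg'`: ported from PFR (`PFR/ForMathlib/Entropy/Kernel/MutualInfo.lean`). [folklore] -/
lemma _root_.Literature.Combinatorics.Additive.PFR.Kernel.mutualInfo_nonneg' {κ : Kernel T (S × U)} {μ : Measure T} [IsFiniteMeasure μ]
    [FiniteSupport μ] (hκ : FiniteKernelSupport κ) :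
    0 ≤ Ik[κ, μ] := by
  simp_rw [mutualInfo, entropy, integral_eq_setIntegral (ae_mem_support μ),
    setIntegral_finset _ .finset, smul_eq_mul]
  rw [← Finset.sum_add_distrib, ← Finset.sum_sub_distrib]
  simp_rw [← mul_add, ← mul_sub, fst_apply, snd_apply]
  have (x : T) : FiniteSupport (κ x) := ⟨hκ x⟩
  exact Finset.sum_nonneg fun x _ ↦ mul_nonneg ENNReal.toReal_nonneg measureMutualInfo_nonneg

/-- `_root_.Literature.Combinatorics.Additive.PFR.Kernel.mutualInfo_nonneg`: ported from PFR (`PFR/ForMathlib/Entropy/Kernel/MutualInfo.lean`). [folklore] -/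
lemma _root_.Literature.Combinatorics.Additive.PFR.Kernel.mutualInfo_nonneg [Countable T] {κ : Kernel T (S × U)} {μ : Measure T} [IsFiniteMeasure μ]
    [FiniteSupport μ] (hκ : AEFiniteKernelSupport κ μ) :
    0 ≤ Ik[κ, μ] := by
  rw [mutualInfo_congr hκ.ae_eq_mk]
  exact mutualInfo_nonneg' hκ.finiteKernelSupport_mk

variable [Countable S] [Countable T]

/-- `_root_.Literature.Combinatorics.Additive.PFR.Kernel.mutualInfo_compProd`: ported from PFR (`PFR/ForMathlib/Entropy/Kernel/MutualInfo.lean`). [folklore] -/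
lemma _root_.Literature.Combinatorics.Additive.PFR.Kernel.mutualInfo_compProd
    {κ : Kernel T S} [IsZeroOrMarkovKernel κ]
    {η : Kernel (T × S) U} [IsMarkovKernel η] {μ : Measure T} [IsZeroOrProbabilityMeasure μ]
    [FiniteSupport μ] (hκ : AEFiniteKernelSupport κ μ) (hη : AEFiniteKernelSupport η (μ ⊗ₘ κ)) :
    Ik[κ ⊗ₖ η, μ] = Hk[κ, μ] + Hk[snd (κ ⊗ₖ η), μ] - Hk[κ ⊗ₖ η, μ] := by
  rw [mutualInfo, entropy_compProd hκ hη, fst_compProd]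

variable [Countable U]

/-- `_root_.Literature.Combinatorics.Additive.PFR.Kernel.mutualInfo_eq_fst_sub`: ported from PFR (`PFR/ForMathlib/Entropy/Kernel/MutualInfo.lean`). [folklore] -/
lemma _root_.Literature.Combinatorics.Additive.PFR.Kernel.mutualInfo_eq_fst_sub [Nonempty S] {κ : Kernel T (S × U)} [IsZeroOrMarkovKernel κ]
    {μ : Measure T} [IsZeroOrProbabilityMeasure μ] [FiniteSupport μ]
    (hκ : AEFiniteKernelSupport κ μ) :
    Ik[κ, μ] = Hk[fst κ, μ] - Hk[condKernel (swapRight κ), μ ⊗ₘ (snd κ)] := by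
  rw [mutualInfo, chain_rule' hκ]
  ring

/-- `_root_.Literature.Combinatorics.Additive.PFR.Kernel.mutualInfo_prod`: ported from PFR (`PFR/ForMathlib/Entropy/Kernel/MutualInfo.lean`). [folklore] -/
@[simp]
lemma _root_.Literature.Combinatorics.Additive.PFR.Kernel.mutualInfo_prod {κ : Kernel T S} {η : Kernel T U}
    [IsZeroOrMarkovKernel κ] [IsZeroOrMarkovKernel η]
    (μ : Measure T) [IsZeroOrProbabilityMeasure μ] [FiniteSupport μ]
    (hκ : AEFiniteKernelSupport κ μ) (hη : AEFiniteKernelSupport η μ) :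
    Ik[κ ×ₖ η, μ] = 0 := by
  rcases eq_zero_or_isMarkovKernel κ with rfl | hκ'
  · simp
  rcases eq_zero_or_isMarkovKernel η with rfl | hη'
  · simp
  rw [mutualInfo, snd_prod, fst_prod, entropy_prod hκ hη, sub_self]

/-- `_root_.Literature.Combinatorics.Additive.PFR.Kernel.mutualInfo_eq_snd_sub`: ported from PFR (`PFR/ForMathlib/Entropy/Kernel/MutualInfo.lean`). [folklore] -/
lemma _root_.Literature.Combinatorics.Additive.PFR.Kernel.mutualInfo_eq_snd_sub [Nonempty U]
    {κ : Kernel T (S × U)} [IsZeroOrMarkovKernel κ]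
    {μ : Measure T} [IsZeroOrProbabilityMeasure μ] [FiniteSupport μ]
    (hκ : AEFiniteKernelSupport κ μ) :
    Ik[κ, μ] = Hk[snd κ, μ] - Hk[condKernel κ, μ ⊗ₘ (fst κ)] := by
  rw [mutualInfo, chain_rule hκ]
  ring

/-- `_root_.Literature.Combinatorics.Additive.PFR.Kernel.entropy_condKernel_le_entropy_fst`: ported from PFR (`PFR/ForMathlib/Entropy/Kernel/MutualInfo.lean`). [folklore] -/
lemma _root_.Literature.Combinatorics.Additive.PFR.Kernel.entropy_condKernel_le_entropy_fst [Nonempty S]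
    (κ : Kernel T (S × U)) [IsZeroOrMarkovKernel κ]
    (μ : Measure T) [IsZeroOrProbabilityMeasure μ] [FiniteSupport μ]
    (hκ : AEFiniteKernelSupport κ μ) :
    Hk[condKernel (swapRight κ), μ ⊗ₘ (snd κ)] ≤ Hk[fst κ, μ] := by
  rw [← sub_nonneg, ← mutualInfo_eq_fst_sub hκ]
  exact mutualInfo_nonneg hκ

/-- `_root_.Literature.Combinatorics.Additive.PFR.Kernel.entropy_condKernel_le_entropy_snd`: ported from PFR (`PFR/ForMathlib/Entropy/Kernel/MutualInfo.lean`). [folklore] -/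
lemma _root_.Literature.Combinatorics.Additive.PFR.Kernel.entropy_condKernel_le_entropy_snd [Nonempty U]
    {κ : Kernel T (S × U)} [IsZeroOrMarkovKernel κ]
    {μ : Measure T} [IsZeroOrProbabilityMeasure μ] [FiniteSupport μ]
    (hκ : AEFiniteKernelSupport κ μ) :
    Hk[condKernel κ, μ ⊗ₘ (fst κ)] ≤ Hk[snd κ, μ] := by
  rw [← sub_nonneg, ← mutualInfo_eq_snd_sub hκ]
  exact mutualInfo_nonneg hκ

/-- `_root_.Literature.Combinatorics.Additive.PFR.Kernel.entropy_snd_sub_mutualInfo_le_entropy_map_of_injective`: ported from PFR (`PFR/ForMathlib/Entropy/Kernel/MutualInfo.lean`). [folklore] -/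
-- TODO: extract lemma(s) from this:
lemma _root_.Literature.Combinatorics.Additive.PFR.Kernel.entropy_snd_sub_mutualInfo_le_entropy_map_of_injective {V : Type*} [Countable V]
    [MeasurableSpace V] [MeasurableSingletonClass V]
    (κ : Kernel T (S × U)) [IsZeroOrMarkovKernel κ] (μ : Measure T) [IsZeroOrProbabilityMeasure μ]
    (f : S × U → V) (hfi : ∀ x, Injective (fun y ↦ f (x, y))) [FiniteSupport μ]
    (hκ : AEFiniteKernelSupport κ μ) :
    Hk[snd κ, μ] - Ik[κ, μ] ≤ Hk[map κ f, μ] := by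
  rcases eq_zero_or_isMarkovKernel κ with rfl | hκ'
  · simp
  rcases eq_zero_or_isProbabilityMeasure μ with rfl | hμ'
  · simp
  have : Nonempty (S × U) := nonempty_of_isProbabilityMeasure_of_isMarkovKernel μ κ
  inhabit (S × U)
  have : Nonempty U := ⟨(default : S × U).2⟩
  have : Nonempty V := ⟨f default⟩
  rw [mutualInfo_eq_snd_sub hκ]
  have hf : Measurable f := by fun_prop
  ring_nf
  calc
    Hk[condKernel κ, μ ⊗ₘ fst κ] = Hk[snd ((condKernel κ) ⊗ₖ
        (deterministic (fun x : (T × S) × U ↦ f (x.1.2, x.2))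
        .of_discrete)), μ ⊗ₘ fst κ] := by
      symm
      apply entropy_snd_compProd_deterministic_of_injective _ _ (fun t ↦ hfi t.2)
    _ = Hk[condKernel (map κ (fun p ↦ (p.1, f p))),
      μ ⊗ₘ fst κ] := entropy_congr (condKernel_map_prodMk_left κ μ f).symm
    _ = Hk[condKernel (map κ (fun p ↦ (p.1, f p))),
      μ ⊗ₘ fst (map κ (fun p ↦ (p.1, f p)))] := by
        congr 2 with x
        rw [fst_map_prod _ hf, fst_apply, map_apply _ measurable_fst]
    _ ≤ Hk[snd (map κ (fun p ↦ (p.1, f p))), μ] :=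
      entropy_condKernel_le_entropy_snd hκ.map
    _ = Hk[map κ f, μ] := by rw [snd_map_prod _ measurable_fst]

end

section

variable [Countable S] [MeasurableSingletonClass S]
  [Countable T] [MeasurableSingletonClass T]
  [Countable U] [MeasurableSingletonClass U]
  [Countable V] [MeasurableSingletonClass V]

/-- `_root_.Literature.Combinatorics.Additive.PFR.Kernel.entropy_reverse`: ported from PFR (`PFR/ForMathlib/Entropy/Kernel/MutualInfo.lean`). [folklore] -/
lemma _root_.Literature.Combinatorics.Additive.PFR.Kernel.entropy_reverse {κ : Kernel T (S × U × V)} [IsZeroOrMarkovKernel κ]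
    {μ : Measure T} [IsZeroOrProbabilityMeasure μ] [FiniteSupport μ]
    (hκ : AEFiniteKernelSupport κ μ) :
    Hk[reverse κ, μ] = Hk[κ, μ] := by
  refine le_antisymm ?_ ?_
  · simpa [reverse_eq] using entropy_map_le (fun p ↦ (p.2.2, p.2.1, p.1)) hκ
  · conv_lhs => rw [← reverse_reverse κ]
    simpa [reverse_eq] using entropy_map_le (fun p ↦ (p.2.2, p.2.1, p.1)) hκ.reverse

/-- `_root_.Literature.Combinatorics.Additive.PFR.Kernel.IsZeroOrProbabilityMeasure.compProd`: ported from PFR (`PFR/ForMathlib/Entropy/Kernel/MutualInfo.lean`). [folklore] -/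
instance _root_.Literature.Combinatorics.Additive.PFR.Kernel.IsZeroOrProbabilityMeasure.compProd
    {α β : Type*} {mα : MeasurableSpace α} {mβ : MeasurableSpace β}
    (μ : Measure α) [IsZeroOrProbabilityMeasure μ] (κ : Kernel α β)
    [IsZeroOrMarkovKernel κ] : IsZeroOrProbabilityMeasure (μ ⊗ₘ κ) := by
  rcases eq_zero_or_isMarkovKernel κ with rfl | hκ
  · simp only [Measure.compProd_zero_right]; infer_instance
  rcases eq_zero_or_isProbabilityMeasure μ with rfl | hμ
  · simp only [Measure.compProd_zero_left]; infer_instance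
  infer_instance

/-- `_root_.Literature.Combinatorics.Additive.PFR.Kernel.entropy_condKernel_compProd_triple`: ported from PFR (`PFR/ForMathlib/Entropy/Kernel/MutualInfo.lean`). [folklore] -/
lemma _root_.Literature.Combinatorics.Additive.PFR.Kernel.entropy_condKernel_compProd_triple [Nonempty V] (ξ : Kernel T S) [IsZeroOrMarkovKernel ξ]
    (κ : Kernel (T × S) U) [IsMarkovKernel κ] (η : Kernel (T × S × U) V) [IsMarkovKernel η]
    (μ : Measure T) :
    Hk[condKernel (ξ ⊗ₖ κ ⊗ₖ η) , μ ⊗ₘ (ξ ⊗ₖ κ)] = Hk[η, μ ⊗ₘ (ξ ⊗ₖ κ)] :=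
  entropy_congr (condKernel_compProd_ae_eq (ξ ⊗ₖ κ) η μ)

/-- `_root_.Literature.Combinatorics.Additive.PFR.Kernel.entropy_submodular_compProd`: ported from PFR (`PFR/ForMathlib/Entropy/Kernel/MutualInfo.lean`). [folklore] -/
-- from kernel (T × S × U) V ; Measure (T × S × U)
-- to kernel (T × S) V ; Measure (T × S)
lemma _root_.Literature.Combinatorics.Additive.PFR.Kernel.entropy_submodular_compProd {ξ : Kernel T S} [IsZeroOrMarkovKernel ξ]
    {κ : Kernel (T × S) U} [IsZeroOrMarkovKernel κ] {η : Kernel (T × S × U) V} [IsMarkovKernel η]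
    {μ : Measure T} [IsZeroOrProbabilityMeasure μ] [FiniteSupport μ]
    (hκ : AEFiniteKernelSupport κ (μ ⊗ₘ ξ))
    (hη : AEFiniteKernelSupport η (μ ⊗ₘ (ξ ⊗ₖ κ))) (hξ : AEFiniteKernelSupport ξ μ) :
    Hk[η, μ ⊗ₘ (ξ ⊗ₖ κ)]
      ≤ Hk[snd (κ ⊗ₖ (comap η MeasurableEquiv.prodAssoc MeasurableEquiv.prodAssoc.measurable)),
            μ ⊗ₘ ξ] := by
  rcases eq_zero_or_isProbabilityMeasure μ with rfl | hμ
  · simp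
  rcases eq_zero_or_isMarkovKernel ξ with rfl | hξ'
  · simp
  have : Nonempty S := nonempty_of_isProbabilityMeasure_of_isMarkovKernel μ ξ
  have : Nonempty T := μ.nonempty_of_neZero
  rcases eq_zero_or_isMarkovKernel κ with rfl | hκ'
  · simp
  have : Nonempty U := nonempty_of_isMarkovKernel κ
  rcases eq_zero_or_isMarkovKernel η with rfl | hκ'
  · simp
  have : Nonempty V := nonempty_of_isMarkovKernel η
  have h_meas := (MeasurableEquiv.prodAssoc.symm : T × S × U ≃ᵐ (T × S) × U).symm.measurable
  have : FiniteSupport (μ ⊗ₘ ξ) := finiteSupport_of_compProd hξ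
  have : FiniteSupport (μ ⊗ₘ (ξ ⊗ₖ κ)) := finiteSupport_of_compProd (hξ.compProd hκ)
  have h := entropy_condKernel_le_entropy_snd
    (κ := κ ⊗ₖ (comap η MeasurableEquiv.prodAssoc h_meas)) (μ := μ ⊗ₘ ξ) ?_
  · simp only [fst_compProd] at h
    have : condKernel (κ ⊗ₖ comap η ↑MeasurableEquiv.prodAssoc h_meas)
        =ᵐ[μ ⊗ₘ ξ ⊗ₘ κ] comap η ↑MeasurableEquiv.prodAssoc h_meas := by
      exact condKernel_compProd_ae_eq κ (comap η _ MeasurableEquiv.prodAssoc.measurable) (μ ⊗ₘ ξ)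
    rwa [entropy_congr this, Measure.compProd_compProd'', entropy_comap_equiv] at h
  · refine (hκ.compProd ?_)
    convert hη.comap_equiv MeasurableEquiv.prodAssoc
    exact Measure.compProd_compProd'' _ _ _

/- $$ H[X,Y,Z] + H[X] \leq H[Z,X] + H[Y,X].$$ -/
/-- `_root_.Literature.Combinatorics.Additive.PFR.Kernel.entropy_compProd_triple_add_entropy_le`: ported from PFR (`PFR/ForMathlib/Entropy/Kernel/MutualInfo.lean`). [folklore] -/
lemma _root_.Literature.Combinatorics.Additive.PFR.Kernel.entropy_compProd_triple_add_entropy_le {ξ : Kernel T S} [IsZeroOrMarkovKernel ξ]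
    {κ : Kernel (T × S) U} [IsMarkovKernel κ]
    {η : Kernel (T × S × U) V} [IsMarkovKernel η]
    {μ : Measure T} [IsZeroOrProbabilityMeasure μ] [FiniteSupport μ]
    (hκ : AEFiniteKernelSupport κ (μ ⊗ₘ ξ))
    (hη : AEFiniteKernelSupport η (μ ⊗ₘ (ξ ⊗ₖ κ))) (hξ : AEFiniteKernelSupport ξ μ) :
    Hk[(ξ ⊗ₖ κ) ⊗ₖ η, μ] + Hk[ξ, μ]
      ≤ Hk[ξ ⊗ₖ snd (κ ⊗ₖ comap η MeasurableEquiv.prodAssoc MeasurableEquiv.prodAssoc.measurable),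
          μ] + Hk[ξ ⊗ₖ κ, μ] := by
  rcases eq_zero_or_isProbabilityMeasure μ with rfl | hμ
  · simp
  rcases eq_zero_or_isMarkovKernel ξ with rfl | hξ'
  · simp
  have : Nonempty S := nonempty_of_isProbabilityMeasure_of_isMarkovKernel μ ξ
  have : Nonempty T := μ.nonempty_of_neZero
  have : Nonempty U := nonempty_of_isMarkovKernel κ
  have : Nonempty V := nonempty_of_isMarkovKernel η
  rw [chain_rule, chain_rule (κ := ξ ⊗ₖ snd (κ ⊗ₖ comap η MeasurableEquiv.prodAssoc
    MeasurableEquiv.prodAssoc.measurable))]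
  · simp only [fst_compProd, entropy_condKernel_compProd_triple]
    calc Hk[ξ ⊗ₖ κ , μ] + Hk[η , μ ⊗ₘ (ξ ⊗ₖ κ)] + Hk[ξ , μ]
      = Hk[ξ , μ] + Hk[ξ ⊗ₖ κ , μ] + Hk[η , μ ⊗ₘ (ξ ⊗ₖ κ)] := by abel
    _ ≤ Hk[ξ , μ] + Hk[ξ ⊗ₖ κ , μ]
      + Hk[condKernel (ξ ⊗ₖ snd (κ ⊗ₖ comap η MeasurableEquiv.prodAssoc _)) , μ ⊗ₘ ξ] := by
        refine add_le_add le_rfl ?_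
        refine (entropy_submodular_compProd hκ hη hξ).trans_eq ?_
        refine entropy_congr ?_
        exact (condKernel_compProd_ae_eq _ _ _).symm
    _ = Hk[ξ , μ] + Hk[condKernel (ξ ⊗ₖ snd (κ ⊗ₖ comap η MeasurableEquiv.prodAssoc _)), μ ⊗ₘ ξ] +
          Hk[ξ ⊗ₖ κ , μ] := by abel
  · refine hξ.compProd ?_
    refine AEFiniteKernelSupport.snd ?_
    refine hκ.compProd ?_
    convert hη.comap_equiv MeasurableEquiv.prodAssoc
    exact Measure.compProd_compProd'' _ _ _
  · exact (hξ.compProd hκ).compProd hη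

/-- The submodularity inequality:
$$ H[X,Y,Z] + H[X] \leq H[X,Z] + H[X,Y].$$ [folklore] -/
lemma _root_.Literature.Combinatorics.Additive.PFR.Kernel.entropy_triple_add_entropy_le' {κ : Kernel T (S × U × V)} [IsZeroOrMarkovKernel κ]
    {μ : Measure T} [IsZeroOrProbabilityMeasure μ] [FiniteSupport μ]
    (hκ : AEFiniteKernelSupport κ μ) :
    Hk[κ, μ] + Hk[fst κ, μ] ≤ Hk[deleteMiddle κ, μ] + Hk[deleteRight κ, μ] := by
  rcases eq_zero_or_isMarkovKernel κ with rfl | hκ'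
  · simp
  rcases eq_zero_or_isProbabilityMeasure μ with rfl | hμ
  · simp
  have : Nonempty (S × U × V) := nonempty_of_isProbabilityMeasure_of_isMarkovKernel μ κ
  inhabit (S × U × V)
  have : Nonempty U := ⟨(default : S × U × V).2.1⟩
  have : Nonempty V := ⟨(default : S × U × V).2.2⟩
  set κ' := map κ MeasurableEquiv.prodAssoc.symm with hκ'_def
  set ξ := fst (fst κ') with ξ_def
  let κ'' := condKernel (fst κ')
  let η := condKernel κ'
  have hξ_eq : ξ = fst κ := by
    rw [ξ_def, hκ'_def, fst_eq, MeasurableEquiv.prodAssoc, MeasurableEquiv.coe_mk, Equiv.coe_fn_mk,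
     fst_eq, map_map _ (by fun_prop) (by fun_prop), map_map _ (by fun_prop) (by fun_prop), fst_eq]
    rfl
  have h_compProd_eq : ξ ⊗ₖ κ'' = fst κ' := (disintegration (fst κ')).symm
  have h_compProd_triple_eq : (ξ ⊗ₖ κ'') ⊗ₖ η = κ' := by
    rw [h_compProd_eq]
    exact (disintegration κ').symm
  have h_compProd_triple_eq' :
      ξ ⊗ₖ (κ'' ⊗ₖ comap η MeasurableEquiv.prodAssoc MeasurableEquiv.prodAssoc.measurable)
        = κ := by
    rw [← compProd_assoc', h_compProd_triple_eq,hκ'_def, map_map _ (by fun_prop) (by fun_prop)]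
    simp
  have h := entropy_compProd_triple_add_entropy_le (ξ := ξ) (κ := κ'') (η := η) (μ := μ) ?_ ?_ ?_
  rotate_left
  · exact aefiniteKernelSupport_of_cond _ hκ.map.fst
  · rw [h_compProd_eq]
    apply aefiniteKernelSupport_of_cond
    exact hκ.map
  · exact hκ.map.fst.fst
  rw [← hξ_eq]
  have h_right : deleteRight κ = fst κ' := by
    rw [hκ'_def, deleteRight_eq, fst_eq, map_map _ (by fun_prop) (by fun_prop)]
    congr
  have h_middle : deleteMiddle κ
      = ξ ⊗ₖ snd
        (κ'' ⊗ₖ comap η MeasurableEquiv.prodAssoc MeasurableEquiv.prodAssoc.measurable) := by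
    rw [← deleteMiddle_compProd, h_compProd_triple_eq']
  have hκ : Hk[κ, μ] = Hk[κ', μ] := by
    rw [hκ'_def, entropy_map_of_injective _ _ _ (by fun_prop)]
    exact MeasurableEquiv.prodAssoc.symm.injective
  rw [h_right, h_middle, hκ, ← h_compProd_triple_eq, fst_compProd]
  · exact h

/-- The submodularity inequality:
$$ H[X,Y,Z] + H[Z] \leq H[X,Z] + H[Y,Z].$$ [folklore] -/
lemma _root_.Literature.Combinatorics.Additive.PFR.Kernel.entropy_triple_add_entropy_le (κ : Kernel T (S × U × V)) [IsZeroOrMarkovKernel κ]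
    (μ : Measure T) [IsZeroOrProbabilityMeasure μ] [FiniteSupport μ]
    (hκ : AEFiniteKernelSupport κ μ) :
    Hk[κ, μ] + Hk[snd (snd κ), μ] ≤ Hk[deleteMiddle κ, μ] + Hk[snd κ, μ] := by
  have h2 : fst (reverse κ) = snd (snd κ) := by
    rw [fst_eq, reverse_eq, snd_eq, map_map _ (by fun_prop) (by fun_prop), snd_eq,
      map_map _ (by fun_prop) (by fun_prop)]
    congr
  rw [← entropy_reverse hκ, ← h2]
  refine (entropy_triple_add_entropy_le' (κ := reverse κ) (μ:= μ) hκ.reverse).trans ?_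
  refine add_le_add ?_ ?_
  · rw [← entropy_swapRight]
    simp
  · rw [← entropy_swapRight]
    simp

end

end ProbabilityTheory.Kernel

end PFR_ForMathlib_Entropy_Kernel_MutualInfo

/-! ## Port of `PFR/ForMathlib/Entropy/Kernel/Group.lean` -/
section PFR_ForMathlib_Entropy_Kernel_Group
/-!
# Kernel entropy and mutual information in a commutative group

## Main definitions

## Main results

-/

open MeasureTheory ProbabilityTheory

variable {Ω Ω' Ω'' Ω''' G T : Type*}
  [MeasurableSpace T]
  [MeasurableSpace G] [MeasurableSingletonClass G] [Group G] [Countable G]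
  {κ : Kernel T G} {μ : Measure T}

namespace Literature.Combinatorics.Additive.PFR
/-- `measureEntropy_inv`: ported from PFR (`PFR/ForMathlib/Entropy/Kernel/Group.lean`). [cite: GowersEtAl2025, Appendix A] -/
@[to_additive (attr := simp)]
lemma measureEntropy_inv (μ : Measure G) : Hm[μ.map (·⁻¹)] = Hm[μ] :=
  measureEntropy_map_of_injective μ _ measurable_inv inv_injective

/-- `measureEntropy_div_comm`: ported from PFR (`PFR/ForMathlib/Entropy/Kernel/Group.lean`). [cite: GowersEtAl2025, Appendix A] -/
@[to_additive]
lemma measureEntropy_div_comm (μ : Measure (G × G)) :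
    Hm[μ.map fun p ↦ p.1 / p.2] = Hm[μ.map fun p ↦ p.2 / p.1] := by
  rw [← measureEntropy_inv, Measure.map_map measurable_inv measurable_div]
  congr with x
  simp

end Literature.Combinatorics.Additive.PFR
namespace ProbabilityTheory.Kernel
open Literature.Combinatorics.Additive.PFR Literature.Combinatorics.Additive.PFR.Kernel

/-- `_root_.Literature.Combinatorics.Additive.PFR.Kernel.entropy_inv`: ported from PFR (`PFR/ForMathlib/Entropy/Kernel/Group.lean`). [cite: GowersEtAl2025, Appendix A] -/
@[to_additive]
lemma _root_.Literature.Combinatorics.Additive.PFR.Kernel.entropy_inv (κ : Kernel T G) (μ : Measure T) : Hk[map κ (·⁻¹), μ] = Hk[κ, μ] :=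
  entropy_map_of_injective κ μ inv_injective measurable_inv

/-- `_root_.Literature.Combinatorics.Additive.PFR.Kernel.entropy_div_comm`: ported from PFR (`PFR/ForMathlib/Entropy/Kernel/Group.lean`). [cite: GowersEtAl2025, Appendix A] -/
@[to_additive]
lemma _root_.Literature.Combinatorics.Additive.PFR.Kernel.entropy_div_comm (κ : Kernel T (G × G)) (μ : Measure T) :
    Hk[map κ (fun p ↦ p.1 / p.2), μ]
      = Hk[map κ (fun p ↦ p.2 / p.1), μ] := by
  rw [← entropy_inv, Kernel.map_map _ (by fun_prop) (by fun_prop)]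
  congr with x
  simp

variable [Countable T] [MeasurableSingletonClass T]

/-- `_root_.Literature.Combinatorics.Additive.PFR.Kernel.entropy_snd_sub_mutualInfo_le_entropy_map_mul`: ported from PFR (`PFR/ForMathlib/Entropy/Kernel/Group.lean`). [cite: GowersEtAl2025, Appendix A] -/
@[to_additive]
lemma _root_.Literature.Combinatorics.Additive.PFR.Kernel.entropy_snd_sub_mutualInfo_le_entropy_map_mul
    (κ : Kernel T (G × G)) [IsZeroOrMarkovKernel κ] (μ : Measure T) [IsZeroOrProbabilityMeasure μ]
    [FiniteSupport μ] (hκ : AEFiniteKernelSupport κ μ) :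
    Hk[snd κ, μ] - Ik[κ, μ] ≤ Hk[map κ (fun p ↦ p.1 * p.2), μ] :=
  entropy_snd_sub_mutualInfo_le_entropy_map_of_injective κ μ _ mul_right_injective hκ

/-- `_root_.Literature.Combinatorics.Additive.PFR.Kernel.entropy_snd_sub_mutualInfo_le_entropy_map_mul'`: ported from PFR (`PFR/ForMathlib/Entropy/Kernel/Group.lean`). [cite: GowersEtAl2025, Appendix A] -/
@[to_additive]
lemma _root_.Literature.Combinatorics.Additive.PFR.Kernel.entropy_snd_sub_mutualInfo_le_entropy_map_mul'
    (κ : Kernel T (G × G)) [IsZeroOrMarkovKernel κ] (μ : Measure T) [IsZeroOrProbabilityMeasure μ]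
    [FiniteSupport μ] (hκ : AEFiniteKernelSupport κ μ) :
    Hk[snd κ, μ] - Ik[κ, μ] ≤ Hk[map κ (fun p ↦ p.2 * p.1), μ] :=
  entropy_snd_sub_mutualInfo_le_entropy_map_of_injective κ μ _ mul_left_injective hκ

/-- `_root_.Literature.Combinatorics.Additive.PFR.Kernel.entropy_fst_sub_mutualInfo_le_entropy_map_mul`: ported from PFR (`PFR/ForMathlib/Entropy/Kernel/Group.lean`). [cite: GowersEtAl2025, Appendix A] -/
@[to_additive]
lemma _root_.Literature.Combinatorics.Additive.PFR.Kernel.entropy_fst_sub_mutualInfo_le_entropy_map_mul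
    (κ : Kernel T (G × G)) [IsZeroOrMarkovKernel κ] (μ : Measure T) [IsZeroOrProbabilityMeasure μ]
    [FiniteSupport μ] (hκ : AEFiniteKernelSupport κ μ) :
    Hk[fst κ, μ] - Ik[κ, μ] ≤ Hk[map κ (fun p ↦ p.1 * p.2), μ] := by
    have h := entropy_snd_sub_mutualInfo_le_entropy_map_mul' (swapRight κ) μ hκ.swapRight
    simp only [snd_swapRight, mutualInfo_swapRight, map_swapRight] at h
    refine h.trans_eq ?_
    have : (fun p : G × G ↦ p.2 * p.1) ∘ Prod.swap = (fun p ↦ p.1 * p.2) := rfl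
    simp_rw [this]

/-- `_root_.Literature.Combinatorics.Additive.PFR.Kernel.entropy_fst_sub_mutualInfo_le_entropy_map_mul'`: ported from PFR (`PFR/ForMathlib/Entropy/Kernel/Group.lean`). [cite: GowersEtAl2025, Appendix A] -/
@[to_additive]
lemma _root_.Literature.Combinatorics.Additive.PFR.Kernel.entropy_fst_sub_mutualInfo_le_entropy_map_mul'
    (κ : Kernel T (G × G)) [IsZeroOrMarkovKernel κ] (μ : Measure T) [IsZeroOrProbabilityMeasure μ]
    [FiniteSupport μ] (hκ : AEFiniteKernelSupport κ μ) :
    Hk[fst κ, μ] - Ik[κ, μ] ≤ Hk[map κ (fun p ↦ p.2 * p.1), μ] := by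
    have h := entropy_snd_sub_mutualInfo_le_entropy_map_mul (swapRight κ) μ hκ.swapRight
    simp only [snd_swapRight, mutualInfo_swapRight, map_swapRight] at h
    refine h.trans_eq ?_
    have : (fun p : G × G ↦ p.1 * p.2) ∘ Prod.swap = (fun p ↦ p.2 * p.1) := rfl
    simp_rw [this]

/-- `_root_.Literature.Combinatorics.Additive.PFR.Kernel.entropy_snd_sub_mutualInfo_le_entropy_map_div`: ported from PFR (`PFR/ForMathlib/Entropy/Kernel/Group.lean`). [cite: GowersEtAl2025, Appendix A] -/
@[to_additive]
lemma _root_.Literature.Combinatorics.Additive.PFR.Kernel.entropy_snd_sub_mutualInfo_le_entropy_map_div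
    (κ : Kernel T (G × G)) [IsZeroOrMarkovKernel κ] (μ : Measure T) [IsZeroOrProbabilityMeasure μ]
    [FiniteSupport μ] (hκ : AEFiniteKernelSupport κ μ) :
    Hk[snd κ, μ] - Ik[κ, μ] ≤ Hk[map κ (fun p ↦ p.1 / p.2), μ] :=
  entropy_snd_sub_mutualInfo_le_entropy_map_of_injective κ μ _ (fun _ ↦ div_right_injective) hκ

/-- `_root_.Literature.Combinatorics.Additive.PFR.Kernel.entropy_fst_sub_mutualInfo_le_entropy_map_div`: ported from PFR (`PFR/ForMathlib/Entropy/Kernel/Group.lean`). [cite: GowersEtAl2025, Appendix A] -/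
@[to_additive]
lemma _root_.Literature.Combinatorics.Additive.PFR.Kernel.entropy_fst_sub_mutualInfo_le_entropy_map_div
    (κ : Kernel T (G × G)) [IsZeroOrMarkovKernel κ] (μ : Measure T) [IsZeroOrProbabilityMeasure μ]
    [FiniteSupport μ] (hκ : AEFiniteKernelSupport κ μ) :
    Hk[fst κ, μ] - Ik[κ, μ] ≤ Hk[map κ (fun p ↦ p.1 / p.2), μ] := by
    have h := entropy_snd_sub_mutualInfo_le_entropy_map_div (swapRight κ) μ hκ.swapRight
    simp only [snd_swapRight, mutualInfo_swapRight, map_swapRight] at h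
    refine h.trans_eq ?_
    have : (fun p : G × G ↦ p.1 / p.2) ∘ Prod.swap = (fun p ↦ p.2 / p.1) := rfl
    simp_rw [this]
    rw [← entropy_div_comm]

/-- `_root_.Literature.Combinatorics.Additive.PFR.Kernel.max_entropy_sub_mutualInfo_le_entropy_mul`: ported from PFR (`PFR/ForMathlib/Entropy/Kernel/Group.lean`). [cite: GowersEtAl2025, Appendix A] -/
@[to_additive]
lemma _root_.Literature.Combinatorics.Additive.PFR.Kernel.max_entropy_sub_mutualInfo_le_entropy_mul
    (κ : Kernel T (G × G)) [IsZeroOrMarkovKernel κ] (μ : Measure T) [IsZeroOrProbabilityMeasure μ]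
    [FiniteSupport μ] (hκ : AEFiniteKernelSupport κ μ) :
    max (Hk[fst κ, μ]) (Hk[snd κ, μ]) - Ik[κ, μ]
      ≤ Hk[map κ (fun p ↦ p.1 * p.2), μ] := by
  rw [← max_sub_sub_right, max_le_iff]
  exact ⟨entropy_fst_sub_mutualInfo_le_entropy_map_mul _ _ hκ,
    entropy_snd_sub_mutualInfo_le_entropy_map_mul _ _ hκ⟩

/-- `_root_.Literature.Combinatorics.Additive.PFR.Kernel.max_entropy_sub_mutualInfo_le_entropy_mul'`: ported from PFR (`PFR/ForMathlib/Entropy/Kernel/Group.lean`). [cite: GowersEtAl2025, Appendix A] -/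
@[to_additive]
lemma _root_.Literature.Combinatorics.Additive.PFR.Kernel.max_entropy_sub_mutualInfo_le_entropy_mul'
    (κ : Kernel T (G × G)) [IsZeroOrMarkovKernel κ] (μ : Measure T) [IsZeroOrProbabilityMeasure μ]
    [FiniteSupport μ] (hκ : AEFiniteKernelSupport κ μ) :
    max (Hk[fst κ, μ]) (Hk[snd κ, μ]) - Ik[κ, μ]
      ≤ Hk[map κ (fun p ↦ p.2 * p.1), μ] := by
  rw [← max_sub_sub_right, max_le_iff]
  exact ⟨entropy_fst_sub_mutualInfo_le_entropy_map_mul' _ _ hκ,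
    entropy_snd_sub_mutualInfo_le_entropy_map_mul' _ _ hκ⟩

/-- `_root_.Literature.Combinatorics.Additive.PFR.Kernel.max_entropy_sub_mutualInfo_le_entropy_div`: ported from PFR (`PFR/ForMathlib/Entropy/Kernel/Group.lean`). [cite: GowersEtAl2025, Appendix A] -/
@[to_additive]
lemma _root_.Literature.Combinatorics.Additive.PFR.Kernel.max_entropy_sub_mutualInfo_le_entropy_div
    (κ : Kernel T (G × G)) [IsZeroOrMarkovKernel κ] (μ : Measure T) [IsZeroOrProbabilityMeasure μ]
    [FiniteSupport μ] (hκ : AEFiniteKernelSupport κ μ) :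
    max (Hk[fst κ, μ]) (Hk[snd κ, μ]) - Ik[κ, μ]
      ≤ Hk[map κ (fun p ↦ p.1 / p.2), μ] := by
  rw [← max_sub_sub_right, max_le_iff]
  exact ⟨entropy_fst_sub_mutualInfo_le_entropy_map_div _ _ hκ,
    entropy_snd_sub_mutualInfo_le_entropy_map_div _ _ hκ⟩

/-- `_root_.Literature.Combinatorics.Additive.PFR.Kernel.max_entropy_le_entropy_mul_prod`: ported from PFR (`PFR/ForMathlib/Entropy/Kernel/Group.lean`). [cite: GowersEtAl2025, Appendix A] -/
@[to_additive]
lemma _root_.Literature.Combinatorics.Additive.PFR.Kernel.max_entropy_le_entropy_mul_prod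
    (κ : Kernel T G) [IsMarkovKernel κ] (η : Kernel T G) [IsMarkovKernel η]
    (μ : Measure T) [IsZeroOrProbabilityMeasure μ] [FiniteSupport μ]
    (hκ : AEFiniteKernelSupport κ μ) (hη : AEFiniteKernelSupport η μ) :
    max (Hk[κ, μ]) (Hk[η, μ]) ≤ Hk[map (κ ×ₖ η) (fun p ↦ p.1 * p.2), μ] := by
  calc max (Hk[κ, μ]) (Hk[η, μ])
    = max (Hk[κ, μ]) (Hk[η, μ]) - Ik[κ ×ₖ η, μ] := by
        rw [mutualInfo_prod _ hκ hη, sub_zero]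
  _ ≤ Hk[map (κ ×ₖ η) (fun p ↦ p.1 * p.2), μ] := by
        convert max_entropy_sub_mutualInfo_le_entropy_mul (κ ×ₖ η) μ (hκ.prod hη)
        · simp
        · simp

/-- `_root_.Literature.Combinatorics.Additive.PFR.Kernel.max_entropy_le_entropy_div_prod`: ported from PFR (`PFR/ForMathlib/Entropy/Kernel/Group.lean`). [cite: GowersEtAl2025, Appendix A] -/
@[to_additive max_entropy_le_entropy_sub_prod]
lemma _root_.Literature.Combinatorics.Additive.PFR.Kernel.max_entropy_le_entropy_div_prod
    (κ : Kernel T G) [IsMarkovKernel κ] (η : Kernel T G) [IsMarkovKernel η]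
    (μ : Measure T) [IsZeroOrProbabilityMeasure μ] [FiniteSupport μ]
    (hκ : AEFiniteKernelSupport κ μ) (hη : AEFiniteKernelSupport η μ) :
    max (Hk[κ, μ]) (Hk[η, μ]) ≤ Hk[map (κ ×ₖ η) (fun p ↦ p.1 / p.2), μ] := by
  calc max (Hk[κ, μ]) (Hk[η, μ])
    = max (Hk[κ, μ]) (Hk[η, μ]) - Ik[κ ×ₖ η, μ] := by
        rw [mutualInfo_prod _ hκ hη, sub_zero]
  _ ≤ Hk[map (κ ×ₖ η) (fun p ↦ p.1 / p.2), μ] := by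
        convert max_entropy_sub_mutualInfo_le_entropy_div (κ ×ₖ η) μ (hκ.prod hη)
        · simp
        · simp

end ProbabilityTheory.Kernel
namespace Literature.Combinatorics.Additive.PFR

end Literature.Combinatorics.Additive.PFR

end PFR_ForMathlib_Entropy_Kernel_Group

/-! ## Port of `PFR/ForMathlib/Entropy/Kernel/RuzsaDist.lean` -/
section PFR_ForMathlib_Entropy_Kernel_RuzsaDist
/-!
# Ruzsa distance between kernels

## Notations

* `dk[κ ; μ # η ; ν] = `
-/

open Real MeasureTheory
open scoped ENNReal NNReal Topology ProbabilityTheory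

namespace ProbabilityTheory.Kernel
open Literature.Combinatorics.Additive.PFR Literature.Combinatorics.Additive.PFR.Kernel

variable {T T' T'' G : Type*} [MeasurableSpace T] [MeasurableSpace T'] [MeasurableSpace T'']
  [MeasurableSpace G] [AddCommGroup G]

/-- The Rusza distance between two measures, defined as `H[X - Y] - H[X]/2 - H[Y]/2` where `X`
and `Y` are independent variables distributed according to the two measures. [cite: GowersEtAl2025, Appendix A (entropic Ruzsa calculus)] -/
noncomputable
def _root_.Literature.Combinatorics.Additive.PFR.Kernel.rdistm (μ ν : Measure G) : ℝ := Hm[(μ.prod ν).map (fun x ↦ x.1 - x.2)] - Hm[μ]/2 - Hm[ν]/2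

/-- The Rusza distance between two kernels taking values in the same space, defined as the average
Rusza distance between the image measures. [cite: GowersEtAl2025, Appendix A (entropic Ruzsa calculus)] -/
noncomputable
def _root_.Literature.Combinatorics.Additive.PFR.Kernel.rdist (κ : Kernel T G) (η : Kernel T' G) (μ : Measure T) (ν : Measure T') : ℝ :=
  (μ.prod ν)[fun p ↦ rdistm (κ p.1) (η p.2)]

/-- The Rusza distance between two kernels taking values in the same space, defined as the average
Rusza distance between the image measures. -/
notation3:max "dk[" κ " ; " μ " # " η " ; " μ' "]" => rdist κ η μ μ'

/-- `_root_.Literature.Combinatorics.Additive.PFR.Kernel.rdist_zero_right`: ported from PFR (`PFR/ForMathlib/Entropy/Kernel/RuzsaDist.lean`). [cite: GowersEtAl2025, Appendix A (entropic Ruzsa calculus)] -/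
@[simp] lemma _root_.Literature.Combinatorics.Additive.PFR.Kernel.rdist_zero_right (κ : Kernel T G) (η : Kernel T' G) (μ : Measure T) :
    dk[κ ; μ # η ; 0] = 0 := by
  simp [rdist]

/-- `_root_.Literature.Combinatorics.Additive.PFR.Kernel.rdist_zero_left`: ported from PFR (`PFR/ForMathlib/Entropy/Kernel/RuzsaDist.lean`). [cite: GowersEtAl2025, Appendix A (entropic Ruzsa calculus)] -/
@[simp] lemma _root_.Literature.Combinatorics.Additive.PFR.Kernel.rdist_zero_left (κ : Kernel T G) (η : Kernel T' G) (ν' : Measure T') :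
    dk[κ ; 0 # η ; ν'] = 0 := by
  simp [rdist]

section

variable [Countable T] [MeasurableSingletonClass T] [Countable T'] [MeasurableSingletonClass T']

/-- `_root_.Literature.Combinatorics.Additive.PFR.Kernel.rdist_eq`: ported from PFR (`PFR/ForMathlib/Entropy/Kernel/RuzsaDist.lean`). [cite: GowersEtAl2025, Appendix A (entropic Ruzsa calculus)] -/
lemma _root_.Literature.Combinatorics.Additive.PFR.Kernel.rdist_eq {κ : Kernel T G} {η : Kernel T' G} {μ : Measure T} {ν : Measure T'}
    [IsProbabilityMeasure μ] [IsProbabilityMeasure ν]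
    [FiniteSupport μ] [FiniteSupport ν] :
    dk[κ ; μ # η ; ν] = (μ.prod ν)[fun p ↦ Hm[((κ p.1).prod (η p.2)).map (fun x ↦ x.1 - x.2)]]
      - Hk[κ, μ]/2 - Hk[η, ν]/2 := by
  rw [rdist]
  simp_rw [rdistm]
  rw [integral_sub, integral_sub]
  · simp_rw [div_eq_mul_inv, integral_mul_const, integral_prod _ (integrable_of_finiteSupport _)]
    simp [entropy]
  all_goals { exact integrable_of_finiteSupport _ }

variable [MeasurableSingletonClass G] [Countable G]

/-- `_root_.Literature.Combinatorics.Additive.PFR.Kernel.rdist_eq'`: ported from PFR (`PFR/ForMathlib/Entropy/Kernel/RuzsaDist.lean`). [cite: GowersEtAl2025, Appendix A (entropic Ruzsa calculus)] -/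
lemma _root_.Literature.Combinatorics.Additive.PFR.Kernel.rdist_eq'
    {κ : Kernel T G} {η : Kernel T' G} [IsFiniteKernel κ] [IsFiniteKernel η]
    {μ : Measure T} {ν : Measure T'} [IsProbabilityMeasure μ] [IsProbabilityMeasure ν]
    [FiniteSupport μ] [FiniteSupport ν] :
    dk[κ ; μ # η ; ν] =
      Hk[map ((prodMkRight T' κ) ×ₖ (prodMkLeft T η)) (fun x ↦ x.1 - x.2), μ.prod ν]
      - Hk[κ, μ]/2 - Hk[η, ν]/2 := by
  rw [rdist_eq]
  congr with p
  simp only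
  rw [map_apply _ (by fun_prop), prod_apply, prodMkLeft_apply, prodMkRight_apply]

/-- `_root_.Literature.Combinatorics.Additive.PFR.Kernel.rdist_symm`: ported from PFR (`PFR/ForMathlib/Entropy/Kernel/RuzsaDist.lean`). [cite: GowersEtAl2025, Appendix A (entropic Ruzsa calculus)] -/
lemma _root_.Literature.Combinatorics.Additive.PFR.Kernel.rdist_symm {κ : Kernel T G} {η : Kernel T' G} [IsFiniteKernel κ] [IsFiniteKernel η]
    {μ : Measure T} {ν : Measure T'} [IsProbabilityMeasure μ] [IsProbabilityMeasure ν]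
    [FiniteSupport μ] [FiniteSupport ν] :
    dk[κ ; μ # η ; ν] = dk[η ; ν # κ ; μ] := by
  rw [rdist_eq', rdist_eq', sub_sub, sub_sub, add_comm]
  congr 1
  rw [← entropy_comap_swap, comap_map_comm _ _ (by fun_prop), entropy_sub_comm, Measure.comap_swap,
    Measure.prod_swap, comap_prod_swap, map_map _ (by fun_prop) (by fun_prop)]
  congr

/-- `_root_.Literature.Combinatorics.Additive.PFR.Kernel.rdist_zero_kernel_right`: ported from PFR (`PFR/ForMathlib/Entropy/Kernel/RuzsaDist.lean`). [cite: GowersEtAl2025, Appendix A (entropic Ruzsa calculus)] -/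
@[simp] lemma _root_.Literature.Combinatorics.Additive.PFR.Kernel.rdist_zero_kernel_right {κ : Kernel T G} [IsFiniteKernel κ]
    {μ : Measure T} {ν : Measure T'} [IsProbabilityMeasure μ] [IsProbabilityMeasure ν]
    [FiniteSupport μ] [FiniteSupport ν] :
    dk[κ ; μ # 0 ; ν] = - Hk[κ, μ] / 2 := by
  rw [rdist_eq']
  simp only [prodMkLeft_zero, entropy_zero_kernel, zero_div, sub_zero]
  rw [sub_eq_iff_eq_add]
  ring_nf
  have : map (prodMkRight T' κ ×ₖ (0 : Kernel (T × T') G)) (fun x ↦ x.1 - x.2)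
      = 0 := by
    ext1 x
    rw [map_apply _ (by fun_prop), prod_apply]
    simp
  rw [this, entropy_zero_kernel]

/-- `_root_.Literature.Combinatorics.Additive.PFR.Kernel.rdist_zero_kernel_left`: ported from PFR (`PFR/ForMathlib/Entropy/Kernel/RuzsaDist.lean`). [cite: GowersEtAl2025, Appendix A (entropic Ruzsa calculus)] -/
@[simp] lemma _root_.Literature.Combinatorics.Additive.PFR.Kernel.rdist_zero_kernel_left {η : Kernel T' G} [IsFiniteKernel η]
    {μ : Measure T} {ν : Measure T'} [IsProbabilityMeasure μ] [IsProbabilityMeasure ν]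
    [FiniteSupport μ] [FiniteSupport ν] :
    dk[0 ; μ # η ; ν] = - Hk[η, ν] / 2 := by
  rw [rdist_symm, rdist_zero_kernel_right]

/-- `_root_.Literature.Combinatorics.Additive.PFR.Kernel.rdist_dirac_zero_right`: ported from PFR (`PFR/ForMathlib/Entropy/Kernel/RuzsaDist.lean`). [cite: GowersEtAl2025, Appendix A (entropic Ruzsa calculus)] -/
@[simp] lemma _root_.Literature.Combinatorics.Additive.PFR.Kernel.rdist_dirac_zero_right {κ : Kernel T G} [IsFiniteKernel κ]
    {μ : Measure T} {ν : Measure T'} [IsProbabilityMeasure μ] [IsProbabilityMeasure ν]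
    [FiniteSupport μ] [FiniteSupport ν] :
    dk[κ ; μ # const T' (Measure.dirac 0) ; ν] = Hk[κ, μ] / 2 := by
  rw [rdist_eq']
  simp only [entropy_const, measure_univ, ENNReal.toReal_one, measureEntropy_dirac, mul_zero,
    zero_div, sub_zero]
  rw [sub_eq_iff_eq_add]
  ring_nf
  have : map (prodMkRight T' κ ×ₖ prodMkLeft T (const T' (Measure.dirac 0)))
        (fun x ↦ x.1 - x.2)
      = prodMkRight T' κ := by
    ext x s hs
    rw [prodMkRight_apply, map_apply _ (by fun_prop), prod_apply, prodMkLeft_apply, const_apply,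
      prodMkRight_apply, Measure.map_apply measurable_sub hs,
      Measure.prod_apply (measurable_sub hs)]
    have (x : G) : Prod.mk x ⁻¹' ((fun p : G × G ↦ p.1 - p.2) ⁻¹' s) = {y | x - y ∈ s} := by
      ext; simp
    simp_rw [this]
    have (x : G) : Set.indicator {y | x - y ∈ s} (1 : G → ℝ≥0∞) 0 = s.indicator (fun _ ↦ 1) x := by
      by_cases hx : x ∈ s <;> simp [hx]
    simp only [Measure.dirac_apply, this]
    rw [lintegral_indicator_const hs, one_mul]
  rw [this, entropy_prodMkRight']

/-- `_root_.Literature.Combinatorics.Additive.PFR.Kernel.rdist_dirac_zero_left`: ported from PFR (`PFR/ForMathlib/Entropy/Kernel/RuzsaDist.lean`). [cite: GowersEtAl2025, Appendix A (entropic Ruzsa calculus)] -/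
@[simp] lemma _root_.Literature.Combinatorics.Additive.PFR.Kernel.rdist_dirac_zero_left {η : Kernel T' G} [IsFiniteKernel η]
    {μ : Measure T} {ν : Measure T'} [IsProbabilityMeasure μ] [IsProbabilityMeasure ν]
    [FiniteSupport μ] [FiniteSupport ν] :
    dk[const T (Measure.dirac 0) ; μ # η ; ν] = Hk[η, ν] / 2 := by
  rw [rdist_symm, rdist_dirac_zero_right]

/-- `_root_.Literature.Combinatorics.Additive.PFR.Kernel.ruzsa_triangle_aux`: ported from PFR (`PFR/ForMathlib/Entropy/Kernel/RuzsaDist.lean`). [cite: GowersEtAl2025, Appendix A (entropic Ruzsa calculus)] -/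
lemma _root_.Literature.Combinatorics.Additive.PFR.Kernel.ruzsa_triangle_aux {T : Type*} [MeasurableSpace T] (κ : Kernel T (G × G)) (η : Kernel T G)
    [IsMarkovKernel κ] [IsMarkovKernel η] :
    map (κ ×ₖ η) (fun p ↦ p.2 - p.1.2)
      = map (η ×ₖ snd κ) (fun p ↦ p.1 - p.2) := by
  have : (fun p : G × G ↦ p.1 - p.2) = (fun p ↦ p.2 - p.1) ∘ Prod.swap := by ext1 p; simp
  rw [this, ← map_map _ measurable_swap .of_discrete, map_prod_swap]
  ext x s hs
  rw [map_apply' _ (by fun_prop) _ hs, map_apply' _ (by fun_prop) _ hs,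
    prod_apply' _ _ _ .of_discrete, prod_apply' _ _ _ .of_discrete, lintegral_snd _ _ .of_discrete]
  congr

/-- `_root_.Literature.Combinatorics.Additive.PFR.Kernel.abs_sub_entropy_le_rdist`: ported from PFR (`PFR/ForMathlib/Entropy/Kernel/RuzsaDist.lean`). [cite: GowersEtAl2025, Appendix A (entropic Ruzsa calculus)] -/
lemma _root_.Literature.Combinatorics.Additive.PFR.Kernel.abs_sub_entropy_le_rdist {κ : Kernel T G} {η : Kernel T' G}
    [IsMarkovKernel κ] [IsMarkovKernel η]
    {μ : Measure T} {ν : Measure T'} [IsProbabilityMeasure μ] [IsProbabilityMeasure ν]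
    [FiniteSupport μ] [FiniteSupport ν]
    (hκ : AEFiniteKernelSupport κ μ) (hη : AEFiniteKernelSupport η ν) :
    |Hk[κ, μ] - Hk[η, ν]| ≤ 2 * dk[κ ; μ # η ; ν] := by
  have h := max_entropy_le_entropy_sub_prod (prodMkRight T' κ) (prodMkLeft T η) (μ.prod ν)
    (hκ.prodMkRight ν) (hη.prodMkLeft μ)
  rw [entropy_prodMkRight', entropy_prodMkLeft] at h
  rw [rdist_eq', abs_le]
  constructor
  · linarith [le_max_right (Hk[κ, μ]) (Hk[η, ν])]
  · linarith [le_max_left (Hk[κ, μ]) (Hk[η, ν])]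

/-- `_root_.Literature.Combinatorics.Additive.PFR.Kernel.rdist_nonneg`: ported from PFR (`PFR/ForMathlib/Entropy/Kernel/RuzsaDist.lean`). [cite: GowersEtAl2025, Appendix A (entropic Ruzsa calculus)] -/
lemma _root_.Literature.Combinatorics.Additive.PFR.Kernel.rdist_nonneg {κ : Kernel T G} {η : Kernel T' G}
    [IsMarkovKernel κ] [IsMarkovKernel η]
    {μ : Measure T} {ν : Measure T'} [IsProbabilityMeasure μ] [IsProbabilityMeasure ν]
    [FiniteSupport μ] [FiniteSupport ν]
    (hκ : AEFiniteKernelSupport κ μ) (hη : AEFiniteKernelSupport η ν) :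
    0 ≤ dk[κ ; μ # η ; ν] := by
  suffices 0 ≤ 2 * dk[κ ; μ # η ; ν] by linarith
  calc 0 ≤ |Hk[κ, μ] - Hk[η, ν]| := abs_nonneg _
  _ ≤ 2 * dk[κ ; μ # η ; ν] := abs_sub_entropy_le_rdist hκ hη

-- Kernel equivalent of `H[X - Y; μ] ≤ H[X - Z; μ] + H[Z - Y; μ] - H[Z; μ]`
-- `κ` is `⟨X,Y⟩`, `η` is `Z`. Independence is expressed through the product `×ₖ`.
/-- The **improved entropic Ruzsa triangle inequality**. [cite: GowersEtAl2025, Appendix A (entropic Ruzsa calculus)] -/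
lemma _root_.Literature.Combinatorics.Additive.PFR.Kernel.ent_of_diff_le (κ : Kernel T (G × G)) (η : Kernel T G) [IsMarkovKernel κ] [IsMarkovKernel η]
    (μ : Measure T) [IsProbabilityMeasure μ] [FiniteSupport μ]
    (hκ : FiniteKernelSupport κ) (hη : FiniteKernelSupport η) :
    Hk[map κ (fun p : G × G ↦ p.1 - p.2), μ]
      ≤ Hk[map ((fst κ) ×ₖ η) (fun p : G × G ↦ p.1 - p.2), μ]
        + Hk[map (η ×ₖ (snd κ)) (fun p : G × G ↦ p.1 - p.2), μ]
        - Hk[η, μ] := by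
  have hκη := hκ.prod hη
  have h1 : Hk[map (κ ×ₖ η) (fun p ↦ (p.1.1 - p.2, (p.1.2, p.1.1 - p.1.2))), μ]
        + Hk[map κ (fun p ↦ p.1 - p.2), μ]
      ≤ Hk[map (κ ×ₖ η) (fun p ↦ (p.1.1 - p.2, p.1.1 - p.1.2)), μ]
        + Hk[map κ (fun p ↦ (p.2, p.1 - p.2)), μ] := by
    have h := entropy_triple_add_entropy_le
      (map (κ ×ₖ η) (fun p ↦ (p.1.1 - p.2, (p.1.2, p.1.1 - p.1.2)))) μ
    simp only [snd_map_prod _ .of_discrete] at h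
    rw [deleteMiddle_map_prod _ .of_discrete] at h
    have : map (κ ×ₖ η) (fun x ↦ x.1.1 - x.1.2)
        = map κ (fun p ↦ p.1 - p.2) := by
      have : (fun x : (G × G) × G ↦ x.1.1 - x.1.2)
        = (fun x ↦ x.1 - x.2) ∘ Prod.fst := by ext1 y; simp
      rw [this, ← map_map _ (by fun_prop) (by fun_prop), ← Kernel.fst_eq, fst_prod]
    rw [this] at h
    refine (h ?_).trans_eq ?_
    · apply FiniteKernelSupport.aefiniteKernelSupport
      apply FiniteKernelSupport.map
      exact hκ.prod hη
    congr 2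
    have : (fun x : (G × G) × G ↦ (x.1.2, x.1.1 - x.1.2))
      = (fun x ↦ (x.2, x.1 - x.2)) ∘ Prod.fst := by ext1 y; simp
    rw [this, ← map_map _ (by fun_prop) (by fun_prop), ← Kernel.fst_eq, fst_prod]
  have h2 : Hk[map (κ ×ₖ η) (fun p ↦ (p.1.1 - p.2, p.1.1 - p.1.2)), μ]
      ≤ Hk[map (κ ×ₖ η) (fun p ↦ p.1.1 - p.2), μ]
        + Hk[map (κ ×ₖ η) (fun p ↦ p.1.2 - p.2), μ] := by
    calc Hk[map (κ ×ₖ η) (fun p ↦ (p.1.1 - p.2, p.1.1 - p.1.2)), μ]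
      ≤ Hk[map (κ ×ₖ η) (fun p ↦ (p.1.1 - p.2, p.1.2 - p.2)), μ] := by
          have : (fun p : (G × G) × G ↦ (p.1.1 - p.2, p.1.1 - p.1.2))
            = (fun p ↦ (p.1, p.1 - p.2)) ∘ (fun p ↦ (p.1.1 - p.2, p.1.2 - p.2)) := by ext1; simp
          rw [this, ← map_map _ (by fun_prop) (by fun_prop)]
          apply entropy_map_le _ _
          apply FiniteKernelSupport.aefiniteKernelSupport
          apply hκη.map
    _ ≤ Hk[map (κ ×ₖ η) (fun p ↦ p.1.1 - p.2), μ]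
        + Hk[map (κ ×ₖ η) (fun p ↦ p.1.2 - p.2), μ] := by
          have h : 0 ≤ Hk[map (κ ×ₖ η) (fun p ↦ p.1.1 - p.2), μ]
              + Hk[map (κ ×ₖ η) (fun p ↦ p.1.2 - p.2), μ]
              - Hk[map (κ ×ₖ η) (fun p ↦ (p.1.1 - p.2, p.1.2 - p.2)), μ] := by
            have h' := mutualInfo_nonneg (κ := map (κ ×ₖ η)
              (fun p ↦ (p.1.1 - p.2, p.1.2 - p.2))) (μ := μ) ?_
            · rwa [mutualInfo, fst_map_prod _ .of_discrete, snd_map_prod _ .of_discrete] at h'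
            apply FiniteKernelSupport.aefiniteKernelSupport
            apply hκη.map
          linarith
  have h3 : Hk[map κ (fun p : G × G ↦ (p.2, p.1 - p.2)), μ]
      ≤ Hk[κ, μ] := by
    exact entropy_map_le _ (hκ.aefiniteKernelSupport _)
  have h4 : Hk[map (κ ×ₖ η) (fun p ↦ (p.1.1 - p.2, (p.1.2, p.1.1 - p.1.2))), μ]
      = Hk[κ ×ₖ η, μ] := by
    refine entropy_of_map_eq_of_map
      (fun p : G × G × G ↦ ((p.2.2 + p.2.1, p.2.1), -p.1 + p.2.2 + p.2.1))
      (fun p : (G × G) × G ↦ (p.1.1 - p.2, (p.1.2, p.1.1 - p.1.2))) ?_ ?_ ?_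
        (hκη.aefiniteKernelSupport _)
    · rw [map_map _ (by fun_prop) (by fun_prop)]
      suffices ((fun p : G × G × G ↦ ((p.2.2 + p.2.1, p.2.1), -p.1 + p.2.2 + p.2.1))
          ∘ fun p ↦ (p.1.1 - p.2, p.1.2, p.1.1 - p.1.2)) = id by
        simp_rw [this, map_id]
      ext1 p
      simp
    · rfl
    apply FiniteKernelSupport.aefiniteKernelSupport
    apply hκη.map
  have h5 : Hk[κ ×ₖ η, μ] = Hk[κ, μ] + Hk[η, μ] := by
    rw [entropy_prod (hκ.aefiniteKernelSupport _) (hη.aefiniteKernelSupport _)]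
  rw [h4, h5] at h1
  calc Hk[map κ (fun p : G × G ↦ p.1 - p.2), μ]
    ≤ Hk[map (κ ×ₖ η) (fun p ↦ p.1.1 - p.2), μ]
      + Hk[map (κ ×ₖ η) (fun p ↦ p.1.2 - p.2), μ] - Hk[η, μ] := by
        linarith
  _ = Hk[map (κ ×ₖ η) (fun p ↦ p.1.1 - p.2), μ]
      + Hk[map (κ ×ₖ η) (fun p ↦ p.2 - p.1.2), μ] - Hk[η, μ] := by
        congr 2
        rw [← entropy_neg, map_map _ (by fun_prop) (by fun_prop)]
        congr with p
        simp
  _ = Hk[map ((fst κ) ×ₖ η) (fun p : G × G ↦ p.1 - p.2), μ]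
      + Hk[map (η ×ₖ (snd κ)) (fun p : G × G ↦ p.1 - p.2), μ]
      - Hk[η, μ] := by
        congr 3
        · ext x s hs
          rw [map_apply' _ (by fun_prop) _ hs, map_apply' _ (by fun_prop) _ hs,
            prod_apply', prod_apply', lintegral_fst]
          · congr with x
          · exact .of_discrete
          · exact measurable_sub hs
          · exact .of_discrete
        · exact ruzsa_triangle_aux κ η

end

-- note : Measure.prod should be made to use dot notation in the infoview

variable [MeasurableSingletonClass T] [MeasurableSingletonClass T'] [MeasurableSingletonClass T'']
variable [MeasurableSingletonClass G] [Countable G]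

/-- `_root_.Literature.Combinatorics.Additive.PFR.Kernel.rdist_triangle_aux1`: ported from PFR (`PFR/ForMathlib/Entropy/Kernel/RuzsaDist.lean`). [cite: GowersEtAl2025, Appendix A (entropic Ruzsa calculus)] -/
lemma _root_.Literature.Combinatorics.Additive.PFR.Kernel.rdist_triangle_aux1 (κ : Kernel T G) (η : Kernel T' G)
    [IsMarkovKernel κ] [IsMarkovKernel η]
    (μ : Measure T) (μ' : Measure T') (μ'' : Measure T'')
    [IsProbabilityMeasure μ] [IsProbabilityMeasure μ'] [IsProbabilityMeasure μ'']
    [FiniteSupport μ] [FiniteSupport μ'] [FiniteSupport μ''] :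
    Hk[map (prodMkRight T' (prodMkRight T'' κ) ×ₖ prodMkLeft (T × T'') η)
          (fun p ↦ p.1 - p.2), (μ.prod μ'').prod μ']
      = Hk[map (prodMkRight T' κ ×ₖ prodMkLeft T η) (fun x ↦ x.1 - x.2),
        μ.prod μ'] := by
  have hAB : ∀ᵐ x ∂(μ.prod μ'), x ∈ ((μ.support ×ˢ μ'.support : Finset (T × T')) : Set (T × T')) :=
    prod_of_full_measure_finset (measure_compl_support μ) (measure_compl_support μ')
  have hAC : (μ.prod μ'') ((μ.support ×ˢ μ''.support : Finset (T × T'')) : Set (T × T''))ᶜ = 0 :=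
    prod_of_full_measure_finset (measure_compl_support μ) (measure_compl_support μ'')
  have hACB : ∀ᵐ x ∂(μ.prod μ'').prod μ', x ∈
      (((μ.support ×ˢ μ''.support) ×ˢ μ'.support : Finset ((T × T'') × T')) : Set ((T × T'') × T'))
        := prod_of_full_measure_finset hAC (measure_compl_support μ')
  simp_rw [entropy, integral_eq_setIntegral hAB, integral_eq_setIntegral hACB,
    setIntegral_finset _ .finset, smul_eq_mul, Measure.prod_real_singleton, Finset.sum_product,
    mul_assoc, ← Finset.mul_sum]
  congr with x
  have : ∀ z y, map (prodMkRight T' (prodMkRight T'' κ) ×ₖ prodMkLeft (T × T'') η)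
        (fun p ↦ p.1 - p.2) ((x, z), y)
      = map (prodMkRight T' κ ×ₖ prodMkLeft T η) (fun p ↦ p.1 - p.2) (x, y) := by
    intro z y
    ext s hs
    rw [map_apply' _ (by fun_prop) _ hs, map_apply' _ (by fun_prop) _ hs, prod_apply, prod_apply]
    simp
  simp_rw [this, ← Finset.sum_mul, sum_measureReal_singleton, Measure.real,
    measure_of_measure_compl_eq_zero (measure_compl_support μ'')]
  simp

/-- `_root_.Literature.Combinatorics.Additive.PFR.Kernel.rdist_triangle_aux2`: ported from PFR (`PFR/ForMathlib/Entropy/Kernel/RuzsaDist.lean`). [cite: GowersEtAl2025, Appendix A (entropic Ruzsa calculus)] -/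
lemma _root_.Literature.Combinatorics.Additive.PFR.Kernel.rdist_triangle_aux2 (η : Kernel T' G) (ξ : Kernel T'' G)
    [IsMarkovKernel η] [IsMarkovKernel ξ]
    (μ : Measure T) (μ' : Measure T') (μ'' : Measure T'')
    [IsProbabilityMeasure μ] [IsProbabilityMeasure μ'] [IsProbabilityMeasure μ'']
    [FiniteSupport μ] [FiniteSupport μ'] [FiniteSupport μ''] :
    Hk[map (prodMkLeft (T × T'') η ×ₖ prodMkRight T' (prodMkLeft T ξ))
      (fun p ↦ p.1 - p.2), (μ.prod μ'').prod μ']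
    = Hk[map (prodMkRight T'' η ×ₖ prodMkLeft T' ξ) (fun x ↦ x.1 - x.2), μ'.prod μ''] := by
  have hBC :
      ∀ᵐ x ∂(μ'.prod μ''), x ∈ ((μ'.support ×ˢ μ''.support : Finset (T' × T'')):Set (T' × T'')) :=
    prod_of_full_measure_finset (measure_compl_support μ') (measure_compl_support μ'')
  have hAC: (μ.prod μ'') ((μ.support ×ˢ μ''.support : Finset (T × T'')):Set (T × T''))ᶜ = 0 :=
    prod_of_full_measure_finset (measure_compl_support μ) (measure_compl_support μ'')
  have hACB : ∀ᵐ x ∂(μ.prod μ'').prod μ', x ∈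
      (((μ.support ×ˢ μ''.support) ×ˢ μ'.support : Finset ((T × T'') × T')) : Set ((T × T'') × T'))
    := prod_of_full_measure_finset hAC (measure_compl_support μ')
  simp_rw [entropy, integral_eq_setIntegral hACB, integral_eq_setIntegral hBC,
    setIntegral_finset _ .finset, smul_eq_mul, Measure.prod_real_singleton]
  conv_rhs => rw [Finset.sum_product_right]
  conv_lhs => rw [Finset.sum_product, Finset.sum_product_right]
  simp_rw [mul_assoc, ← Finset.mul_sum]
  congr with z
  have : ∀ x y, map (prodMkLeft (T × T'') η ×ₖ prodMkRight T' (prodMkLeft T ξ))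
        (fun p ↦ p.1 - p.2) ((x, z), y)
      = map (prodMkLeft T'' η ×ₖ prodMkRight T' ξ) (fun p ↦ p.1 - p.2) (z, y) := by
    intro x y
    ext s hs
    rw [map_apply' _ (by fun_prop) _ hs, map_apply' _ (by fun_prop) _ hs, prod_apply, prod_apply]
    simp
  simp_rw [this, ← Finset.sum_mul, sum_measureReal_singleton, Measure.real,
    measure_of_measure_compl_eq_zero (measure_compl_support μ),
    measure_univ, ENNReal.toReal_one, one_mul, ← mul_assoc, mul_comm _ (μ'' {z}).toReal, mul_assoc,
    ← Finset.mul_sum]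
  congr with y
  congr 2 with s _hs
  rw [map_apply _ (by fun_prop), map_apply _ (by fun_prop), prod_apply, prod_apply]
  simp

variable [Countable T] [Countable T'] [Countable T'']

/-- `_root_.Literature.Combinatorics.Additive.PFR.Kernel.rdist_triangle`: ported from PFR (`PFR/ForMathlib/Entropy/Kernel/RuzsaDist.lean`). [cite: GowersEtAl2025, Appendix A (entropic Ruzsa calculus)] -/
lemma _root_.Literature.Combinatorics.Additive.PFR.Kernel.rdist_triangle (κ : Kernel T G) (η : Kernel T' G) (ξ : Kernel T'' G)
    [IsMarkovKernel κ] [IsMarkovKernel η] [IsMarkovKernel ξ]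
    (μ : Measure T) (μ' : Measure T') (μ'' : Measure T'')
    [IsProbabilityMeasure μ] [IsProbabilityMeasure μ'] [IsProbabilityMeasure μ'']
    [FiniteSupport μ] [FiniteSupport μ'] [FiniteSupport μ'']
    (hκ : FiniteKernelSupport κ) (hη : FiniteKernelSupport η) (hξ : FiniteKernelSupport ξ) :
    dk[κ ; μ # ξ ; μ''] ≤ dk[κ ; μ # η ; μ'] + dk[η ; μ' # ξ ; μ''] := by
  rw [rdist_eq', rdist_eq', rdist_eq']
  have h := ent_of_diff_le (prodMkRight T' (prodMkRight T'' κ ×ₖ prodMkLeft T ξ))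
    (prodMkLeft (T × T'') η) ((μ.prod μ'').prod μ') ?_ ?_
  rotate_left
  · apply FiniteKernelSupport.prodMkRight
    apply hκ.prodMkRight.prod hξ.prodMkLeft
  · apply Kernel.FiniteKernelSupport.prodMkLeft hη
  have h1 : Hk[map (prodMkRight T' (prodMkRight T'' κ ×ₖ prodMkLeft T ξ)) (fun p ↦ p.1 - p.2),
      (μ.prod μ'').prod μ']
      = Hk[map (prodMkRight T'' κ ×ₖ prodMkLeft T ξ) (fun x ↦ x.1 - x.2), μ.prod μ''] := by
    rw [map_prodMkRight, entropy_prodMkRight']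
  have h2 :
      Hk[map (fst (prodMkRight T' (prodMkRight T'' κ ×ₖ prodMkLeft T ξ)) ×ₖ prodMkLeft (T × T'') η)
          (fun p ↦ p.1 - p.2), (μ.prod μ'').prod μ']
      = Hk[map (prodMkRight T' κ ×ₖ prodMkLeft T η) (fun x ↦ x.1 - x.2), μ.prod μ'] := by
    rw [fst_prodMkRight, fst_prod]
    exact rdist_triangle_aux1 _ _ _ _ _
  have h3 :
      Hk[map (prodMkLeft (T × T'') η ×ₖ snd (prodMkRight T' (prodMkRight T'' κ ×ₖ prodMkLeft T ξ)))
        (fun p ↦ p.1 - p.2), (μ.prod μ'').prod μ']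
      = Hk[map (prodMkRight T'' η ×ₖ prodMkLeft T' ξ) (fun x ↦ x.1 - x.2), μ'.prod μ''] := by
    rw [snd_prodMkRight, snd_prod]
    exact rdist_triangle_aux2 _ _ _ _ _
  have h4 : Hk[prodMkLeft (T × T'') η, (μ.prod μ'').prod μ'] = Hk[η, μ'] := entropy_prodMkLeft
  rw [h1, h2, h3, h4] at h
  calc Hk[map (prodMkRight T'' κ ×ₖ prodMkLeft T ξ) (fun x ↦ x.1 - x.2), μ.prod μ'']
      - Hk[κ , μ] / 2 - Hk[ξ , μ''] / 2
    ≤ Hk[map (prodMkRight T' κ ×ₖ prodMkLeft T η) (fun x ↦ x.1 - x.2), μ.prod μ']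
      + Hk[map (prodMkRight T'' η ×ₖ prodMkLeft T' ξ) (fun x ↦ x.1 - x.2),
        μ'.prod μ'']
      - Hk[η, μ'] - Hk[κ , μ] / 2 - Hk[ξ , μ''] / 2 := by gcongr
  _ = Hk[map (prodMkRight T' κ ×ₖ prodMkLeft T η) (fun x ↦ x.1 - x.2), μ.prod μ']
      - Hk[κ , μ] / 2 - Hk[η , μ'] / 2
      + (Hk[map (prodMkRight T'' η ×ₖ prodMkLeft T' ξ) (fun x ↦ x.1 - x.2), μ'.prod μ'']
      - Hk[η , μ'] / 2 - Hk[ξ , μ''] / 2) := by ring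

end ProbabilityTheory.Kernel

end PFR_ForMathlib_Entropy_Kernel_RuzsaDist
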